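import Literature.Computability.QuantumComplexity.ControlledHadamard
import Literature.Computability.QuantumComplexity.CircuitEmbedding
import Literature.Computability.QuantumComplexity.RevTableau
import Literature.Computability.Cryptography.OracleKickback
import Literature.Computability.QuantumComplexity.OracleSeparationBQPPH
import HarnessLib

/-!
# The Raz–Tal `BQP^O` machine, I: one run of the one-query Forrelation algorithm as a circuit

Towards the discharge of the named fact `RazTal2022_bqpMachine` of
`OracleSeparationBQPPH.lean` (Raz–Tal, J. ACM 69 (2022), App. A with Claim 8.1 and §6: "the
machine `M` on input `1ⁿ` would run the quantum algorithm `Q₁` from Claim 8.1 on the oracle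
string provided by `O`"; `Q₁` runs the one-query Forrelation algorithm `Q` of Aaronson–Ambainis
(STOC 2015, Prop. 6) independently `m` times and accepts by a threshold). This file builds and
analyses the circuit of **one run** of `Q` on block `i` of the level-`n` window, over the
Clifford+T gate set with XOR oracle gates (H21's `BQPRel` model, `QuantumCircuit.lean`):

* `RtOp α` — the operations used (classical `NOT`/`CNOT`/Toffoli via `ClOp`, Hadamard,
  controlled Hadamard, oracle query) over an abstract wire type, `RtOp.map`, `RtOp.WF`,
  `RtOp.compile`/`compileList` into `QGate cliffordT N` for wires in `Fin N` (`X = HSSH`,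
  Toffoli `= H·CCZ·H` from `ReversibleCliffordT`, `CH` from `ControlledHadamard`), and the
  transport of compilation along wire embeddings (`compileList_map_embed`);
* `hLayerE e` — a layer of Hadamard gates on an embedded sub-register and its matrix
  `placeGate e H^{⊗k}` (`toMatrix_hLayerE`; port of `toMatrix_map_hCCSignHOn`);
* the **block layout** on `Bsz n L` wires (address qubit `l ≤ n` on wire `l`, `aEmb`; `hW = n`
  the half selector, i.e. the top address qubit; `tW` the phase-kick-back target; `oW` a
  constant-`1` seed wire; `bW l` the block-index register of `L` bits; `kW r l` the carries of
  the `r`-th increment) and the **block program** `blockOps n L i`: `i` ripple-carry increments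
  writing `i` in binary on the index register (`incrOps`, `prefixOps`, invariant `IncInv`,
  `cPre_bW : (prefix state) (bW l) = testBit i l`), then the quantum part `quantOps`: `|−⟩` on
  the target (`X`, `H`), `H^{⊗(n+1)}` on the address, **one oracle query** on the `n + 1 + L`
  address-and-index wires (`queryWires`; the queried string at address `k` is
  `natBits (n+1) k ++ natBits L i`, which for `L = rtIdxBits n` is `rtAddr n i k`, the address of
  bit `k` of block `i` of the level-`n` window — `blockWindow`, `cWindow_cPre`), and the mixing
  unitary `V = H_h · CH^{⊗n}` (controlled Hadamards on the low address qubits, controlled by the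
  half selector `h`, then `H` on `h`), cf. `RazTalForrelation.mixMatrix`;
* `Qloc n L i` — the compiled block circuit — and its semantics: the address register with the
  target in `|−⟩` is tracked by `dState c β = ∑_y β(y) (|cfg c y 0⟩ − |cfg c y 1⟩)` through the
  six segments of `quantOps` (`seg12_mulVec` … `seg6_mulVec`, phase kick-back
  `oracle_mulVec_dState`, `chLayer_mulVec_dState`), giving
  `compileList_quantOps_mulVec : … *ᵥ |c⟩ = 2^{-(n+2)/2} • dState c blockAmp` and
  `Qloc_mulVec_zero`; the closed form of the final amplitudes
  `blockAmp (u, b) = (x_u + (−1)^b (H_N y)_u)/√2` (`blockAmp_snoc`; `x`, `y` the two halves of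
  the block read in `{±1}`, `hGateAll_eq_hadamardMatrix`); and the Born weights of the half
  selector, **`sum_ite_normSq_Qloc : ∑_{z : z_h = b} |(Qloc *ᵥ |0…0⟩)(z)|² =
  if b then 1 − blockAcc n (blockWindow A n L i) else blockAcc n (blockWindow A n L i)`** — one
  run on block `i` accepts (half selector `0`) with probability exactly `(1 + φ(block i))/2`
  (Raz–Tal §6; Aaronson–Ambainis Prop. 6; `sum_sq_mix` of `RazTalForrelation.lean`).

The assembly of the `m` blocks with the threshold count (acceptance probability `q1Accept`) and
the uniformity of the family are in the sequel files. Everything lives in the namespace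
`Literature.QuantumAdvantage.RazTalMachine`.

## References

* R. Raz, A. Tal, *Oracle separation of BQP and PH*, J. ACM 69 (2022), §2.2, §6, Claim 8.1,
  App. A [RazTalJACM2022].
* S. Aaronson, A. Ambainis, *Forrelation: a problem that optimally separates quantum from
  classical computing*, STOC 2015 / SIAM J. Comput. 47 (2018), Prop. 6 [AaronsonAmbainis2018].
* M. A. Nielsen, I. L. Chuang, *Quantum Computation and Quantum Information*, CUP 2010, §1.4.4
  (`H^{⊗n}`), §3.2.5 (reversible circuits from Toffoli gates and ancilla bits), §4.3 (controlled
  operations), §6.1.1 (the oracle, phase kick-back).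
* S. Arora, B. Barak, *Computational Complexity: A Modern Approach*, CUP 2009, §10.3.7,
  Lemma 10.10 (classical circuits as `NOT`/`CNOT`/Toffoli quantum circuits) [AroraBarak2009].
-/

noncomputable section

namespace Literature.Computability.QuantumComplexity

open _root_.Computability Complexity Cryptography Literature.Probability.RandomGraphs.LowDegree Matrix Finset RevSim

namespace RazTalMachine

/-! ### Operations over an abstract wire type and their compilation -/

/-- The operations of the Raz–Tal block circuits over a wire type `α`: a classical reversible
operation (`ClOp`: `NOT`, `CNOT`, Toffoli), a Hadamard gate, a controlled-Hadamard gate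
(control, target), an oracle query (query wires, answer wire). [cite: RazTalJACM2022, App. A] -/
inductive RtOp (α : Type)
  /-- a classical reversible operation -/
  | cl (op : ClOp α)
  /-- a Hadamard gate on a wire -/
  | had (a : α)
  /-- a controlled-Hadamard gate with control `c` and target `a` -/
  | chad (c a : α)
  /-- an oracle query on the wires `qs` with answer wire `t` -/
  | oracle (qs : List α) (t : α)

namespace RtOp

variable {α β : Type}

/-- Re-indexing the wires. [folklore] -/
def map (f : α → β) : RtOp α → RtOp β
  | cl op => cl (op.map f)
  | had a => had (f a)
  | chad c a => chad (f c) (f a)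
  | oracle qs t => oracle (qs.map f) (f t)

/-- The wires of an operation. [folklore] -/
def wires : RtOp α → List α
  | cl op => wiresOf op
  | had a => [a]
  | chad c a => [c, a]
  | oracle qs t => qs ++ [t]

/-- Well-formedness: the wires that must be distinct are distinct. [folklore] -/
def WF : RtOp α → Prop
  | cl op => op.WF
  | had _ => True
  | chad c a => c ≠ a
  | oracle qs t => (qs ++ [t]).Nodup

/-- `map` composes. [folklore] -/
theorem map_map {γ : Type} (f : α → β) (g : β → γ) (op : RtOp α) : (op.map f).map g = op.map (g ∘ f) := by
  cases op with
  | cl op => cases op <;> rfl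
  | had a => rfl
  | chad c a => rfl
  | oracle qs t => simp [map, List.map_map]

/-- The wires of a re-indexed operation. [folklore] -/
theorem wires_map (f : α → β) (op : RtOp α) : (op.map f).wires = op.wires.map f := by
  cases op with
  | cl op => cases op <;> rfl
  | had a => rfl
  | chad c a => rfl
  | oracle qs t => simp [map, wires]

/-- Re-indexing along a map injective on the wires preserves well-formedness. [folklore] -/
theorem WF.map_of_injOn {f : α → β} {op : RtOp α} (h : op.WF)
    (hf : ∀ a ∈ op.wires, ∀ a' ∈ op.wires, f a = f a' → a = a') : (op.map f).WF := by
  cases op with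
  | cl op =>
    cases op with
    | not i => trivial
    | cnot i j => exact fun e => h (hf i (by simp [wires, wiresOf, ClOp.target, ClOp.controls]) j
        (by simp [wires, wiresOf, ClOp.target, ClOp.controls]) e)
    | toffoli a b c =>
      obtain ⟨h1, h2, h3⟩ := h
      have hm : ∀ x, x = a ∨ x = b ∨ x = c → x ∈ (cl (ClOp.toffoli a b c) : RtOp α).wires := by
        intro x hx; simp only [wires, wiresOf, ClOp.target, ClOp.controls, List.mem_cons, List.not_mem_nil, or_false]
        tauto
      exact ⟨fun e => h1 (hf a (hm a (by simp)) b (hm b (by simp)) e), fun e => h2 (hf a (hm a (by simp)) c (hm c (by simp)) e),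
        fun e => h3 (hf b (hm b (by simp)) c (hm c (by simp)) e)⟩
  | had a => trivial
  | chad c a => exact fun e => h (hf c (by simp [wires]) a (by simp [wires]) e)
  | oracle qs t =>
    change ((qs.map f) ++ [f t]).Nodup
    rw [show qs.map f ++ [f t] = (qs ++ [t]).map f by simp]
    exact List.Nodup.map_on (fun x hx y hy e => hf x hx y hy e) h

end RtOp

/-- The wire embedding of an oracle query: query wires `qs` (in order), then the answer wire `t`.
[cite: NielsenChuang2010, §6.1.1] -/
def oracleEmb {N : ℕ} (qs : List (Fin N)) (t : Fin N) (h : (qs ++ [t]).Nodup) : Fin (qs.length + 1) ↪ Fin N :=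
  ⟨fun i => (qs ++ [t]).get (Fin.cast (by simp) i), fun i j hij => by
    have := (List.nodup_iff_injective_get.1 h) hij
    simpa [Fin.ext_iff] using this⟩

/-- The query wires of `oracleEmb`. [folklore] -/
theorem oracleEmb_castSucc {N : ℕ} (qs : List (Fin N)) (t : Fin N) (h : (qs ++ [t]).Nodup) (j : Fin qs.length) :
    oracleEmb qs t h j.castSucc = qs[j.val] := by
  simp [oracleEmb, List.getElem_append_left]

/-- The answer wire of `oracleEmb`. [folklore] -/
theorem oracleEmb_last {N : ℕ} (qs : List (Fin N)) (t : Fin N) (h : (qs ++ [t]).Nodup) :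
    oracleEmb qs t h (Fin.last qs.length) = t := by
  simp [oracleEmb]

namespace RtOp

variable {N : ℕ}

/-- **Compilation of a well-formed operation into Clifford+T gates with oracle queries**:
classical operations via `RevOp.compile` (`X = HSSH`, `CNOT`, Toffoli `= H·CCZ·H`), `H`, the
controlled-Hadamard word `chWord`, and the oracle gate on `oracleEmb`. [cite: RazTalJACM2022, App. A] -/
def compile : (op : RtOp (Fin N)) → op.WF → List (QGate cliffordT N)
  | cl op, h => (op.toRev h).compile
  | had a, _ => [hOn a]
  | chad c a, h => chWord c a h
  | oracle qs t, h => [QGate.oracle qs.length (oracleEmb qs t h)]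

/-- Compilation of a program of well-formed operations. [folklore] -/
def compileList : (ops : List (RtOp (Fin N))) → (∀ op ∈ ops, op.WF) → List (QGate cliffordT N)
  | [], _ => []
  | op :: ops, h => op.compile (h op (by simp)) ++ compileList ops (fun o ho => h o (by simp [ho]))

/-- `compileList` of a concatenation. [folklore] -/
theorem compileList_append (ops ops' : List (RtOp (Fin N))) (h : ∀ op ∈ ops ++ ops', op.WF) :
    compileList (ops ++ ops') h =
      compileList ops (fun o ho => h o (List.mem_append_left _ ho)) ++
        compileList ops' (fun o ho => h o (List.mem_append_right _ ho)) := by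
  induction ops with
  | nil => rfl
  | cons op ops ih =>
    change op.compile _ ++ compileList (ops ++ ops') _ = (op.compile _ ++ compileList ops _) ++ compileList ops' _
    rw [ih (fun o ho => h o (List.mem_cons_of_mem _ ho))]
    rw [List.append_assoc]

/-- `compileList` does not depend on the well-formedness proof. [folklore] -/
theorem compileList_congr {ops ops' : List (RtOp (Fin N))} (e : ops = ops') (h : ∀ op ∈ ops, op.WF)
    (h' : ∀ op ∈ ops', op.WF) : compileList ops h = compileList ops' h' := by
  subst e; rfl

/-- `compileList` of a `cons`. [folklore] -/
theorem compileList_cons (op : RtOp (Fin N)) (ops : List (RtOp (Fin N))) (h : ∀ o ∈ op :: ops, o.WF) :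
    compileList (op :: ops) h = op.compile (h op (by simp)) ++ compileList ops (fun o ho => h o (by simp [ho])) := rfl

/-- The number of gates of a compiled operation: at most `24` for classical operations, `20` for a
controlled Hadamard, `1` otherwise. [folklore] -/
theorem length_compile_le (op : RtOp (Fin N)) (h : op.WF) : (op.compile h).length ≤ 24 := by
  cases op with
  | cl op => cases op <;> simp [compile, ClOp.toRev, RevOp.compile, xWord, toffoliWord, cczWord]
  | had a => simp [compile]
  | chad c a => simp [compile, length_chWord]
  | oracle qs t => simp [compile]

/-- The number of gates of a compiled program is at most `24` per operation. [folklore] -/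
theorem length_compileList_le : ∀ (ops : List (RtOp (Fin N))) (h : ∀ op ∈ ops, op.WF),
    (compileList ops h).length ≤ 24 * ops.length
  | [], _ => by simp [compileList]
  | op :: ops, h => by
    rw [compileList_cons, List.length_append, List.length_cons]
    have h1 := length_compile_le op (h op (by simp))
    have h2 := length_compileList_le ops (fun o ho => h o (by simp [ho]))
    omega

end RtOp

/-! ### Transport of compilation along a wire embedding -/

section Embed

variable {b W : ℕ} (E : Fin b ↪ Fin W)

/-- `hOn` transported along `E`. [folklore] -/
theorem hOn_embed (a : Fin b) : mapWiresGate E (hOn a) = hOn (E a) := rfl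

/-- `sOn` transported along `E`. [folklore] -/
theorem sOn_embed (a : Fin b) : mapWiresGate E (sOn a) = sOn (E a) := rfl

/-- `tOn` transported along `E`. [folklore] -/
theorem tOn_embed (a : Fin b) : mapWiresGate E (tOn a) = tOn (E a) := rfl

/-- `cnotOn` transported along `E`. [folklore] -/
theorem cnotOn_embed (i j : Fin b) (h : i ≠ j) :
    mapWiresGate E (cnotOn i j h) = cnotOn (E i) (E j) (fun e => h (E.injective e)) := by
  simp only [cnotOn, mapWiresGate]
  congr 1
  ext k
  fin_cases k <;> rfl

/-- `xWord` transported along `E`. [folklore] -/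
theorem xWord_embed (a : Fin b) : (xWord a).map (mapWiresGate E) = xWord (E a) := by
  simp [xWord, hOn_embed, sOn_embed]

/-- `cczWord` transported along `E`. [folklore] -/
theorem cczWord_embed (a c d : Fin b) (hac : a ≠ c) (had : a ≠ d) (hcd : c ≠ d) :
    (cczWord a c d hac had hcd).map (mapWiresGate E) =
      cczWord (E a) (E c) (E d) (fun e => hac (E.injective e)) (fun e => had (E.injective e))
        (fun e => hcd (E.injective e)) := by
  simp [cczWord, tOn_embed, sOn_embed, cnotOn_embed]

/-- `toffoliWord` transported along `E`. [folklore] -/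
theorem toffoliWord_embed (a c d : Fin b) (hac : a ≠ c) (had : a ≠ d) (hcd : c ≠ d) :
    (toffoliWord a c d hac had hcd).map (mapWiresGate E) =
      toffoliWord (E a) (E c) (E d) (fun e => hac (E.injective e)) (fun e => had (E.injective e))
        (fun e => hcd (E.injective e)) := by
  rw [toffoliWord, toffoliWord, List.map_cons, List.map_append, cczWord_embed]
  simp [hOn_embed]

/-- `chWord` transported along `E`. [folklore] -/
theorem chWord_embed (c a : Fin b) (h : c ≠ a) :
    (chWord c a h).map (mapWiresGate E) = chWord (E c) (E a) (fun e => h (E.injective e)) := by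
  have hw : ∀ l : List G1, (wireWord a l).map (mapWiresGate E) = wireWord (E a) l := by
    intro l
    simp only [wireWord, List.map_map]
    refine List.map_congr_left fun g _ => ?_
    cases g
    · exact hOn_embed E a
    · exact sOn_embed E a
    · exact tOn_embed E a
  rw [chWord, chWord, List.map_append, List.map_append, hw, hw]
  simp [czWord, hOn_embed, cnotOn_embed]

/-- The well-formedness of a re-indexed operation along an embedding. [folklore] -/
theorem RtOp.WF.map_embedding {op : RtOp (Fin b)} (h : op.WF) : (op.map E).WF :=
  h.map_of_injOn fun _ _ _ _ e => E.injective e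

/-- **A compiled operation transported along `E` is the compilation of the re-indexed
operation.** [folklore] -/
theorem RtOp.compile_map_embed (op : RtOp (Fin b)) (h : op.WF) (h' : (op.map E).WF) :
    (op.compile h).map (mapWiresGate E) = (op.map E).compile h' := by
  cases op with
  | cl op =>
    cases op with
    | not i => exact xWord_embed E i
    | cnot i j => simp [RtOp.compile, RtOp.map, ClOp.map, ClOp.toRev, RevOp.compile, cnotOn_embed]
    | toffoli a c d => exact toffoliWord_embed E a c d _ _ _
  | had a => simp [RtOp.compile, RtOp.map, hOn_embed]
  | chad c a => exact chWord_embed E c a h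
  | oracle qs t =>
    simp only [RtOp.compile, RtOp.map, List.map_cons, List.map_nil, mapWiresGate, List.cons.injEq, and_true]
    have hlen : (qs.map E).length = qs.length := List.length_map _
    -- the two oracle gates have the same arity and the same wire embedding
    have key : ∀ (k k' : ℕ) (hk : k = k') (e : Fin (k + 1) ↪ Fin W) (e' : Fin (k' + 1) ↪ Fin W),
        (∀ i : Fin (k + 1), (e i : ℕ) = e' (Fin.cast (by rw [hk]) i)) →
        (QGate.oracle k e : QGate cliffordT W) = QGate.oracle k' e' := by
      rintro k k' rfl e e' he
      congr 1
      ext i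
      rw [he i]
      rfl
    refine key qs.length (qs.map E).length hlen.symm ((oracleEmb qs t h).trans E) (oracleEmb (qs.map E) (E t) h')
      fun i => ?_
    simp only [Function.Embedding.trans_apply, oracleEmb, Function.Embedding.coeFn_mk, List.get_eq_getElem,
      Fin.val_cast]
    rw [List.getElem_append, List.getElem_append]
    simp only [List.length_map, List.getElem_map]
    split_ifs <;> simp

/-- **A compiled program transported along `E` is the compilation of the re-indexed program.**
[folklore] -/
theorem RtOp.compileList_map_embed : ∀ (ops : List (RtOp (Fin b))) (h : ∀ op ∈ ops, op.WF)
    (h' : ∀ op ∈ ops.map (RtOp.map E), op.WF),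
    (RtOp.compileList ops h).map (mapWiresGate E) = RtOp.compileList (ops.map (RtOp.map E)) h'
  | [], _, _ => rfl
  | op :: ops, h, h' => by
    rw [RtOp.compileList_cons, List.map_append, RtOp.compile_map_embed E op _ (h' _ (by simp)),
      RtOp.compileList_map_embed ops _ (fun o ho => h' o (by simp only [List.map_cons, List.mem_cons]; exact Or.inr ho))]
    rfl

end Embed

/-! ### Hadamard layers on an embedded sub-register -/

section HLayer

variable {N k : ℕ}

/-- Hadamard gates (Clifford+T `H`) on the distinct wires `ws`, as a matrix: `∏_{a ∈ ws} ⟨x_a|H|y_a⟩`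
if `x` and `y` agree off `ws`, else `0` (port of `toMatrix_map_hCCSignHOn`).
[cite: NielsenChuang2010, §1.4.4] -/
theorem toMatrix_map_hOn (A : Language Bool) (ws : List (Fin N)) (hws : ws.Nodup) (x y : QReg N) :
    (⟨ws.map hOn⟩ : QCircuit cliffordT N).toMatrix A x y =
      if (∀ i, i ∉ ws → x i = y i) then (ws.map fun a => hadamardEntry (x a) (y a)).prod else 0 := by
  induction ws generalizing y with
  | nil =>
    simp only [List.map_nil, QCircuit.toMatrix_nil, Matrix.one_apply, List.not_mem_nil,
      not_false_eq_true, forall_const, List.prod_nil]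
    simp [funext_iff]
  | cons a ws ih =>
    have ha : a ∉ ws := (List.nodup_cons.1 hws).1
    rw [List.map_cons, QCircuit.toMatrix_cons, hOn_toMatrix, mul_placeGate_apply,
      sum_qReg_one, Finset.sum_eq_single (x a)]
    · simp only [extend_fin_one, wireEmb_apply, ih (List.nodup_cons.1 hws).2, hGate_apply_eq_hadamardEntry,
        Function.comp_apply]
      have hP : (ws.map fun a' => hadamardEntry (x a') (Function.update y a (x a) a')).prod =
          (ws.map fun a' => hadamardEntry (x a') (y a')).prod := by
        refine congrArg List.prod (List.map_congr_left fun a' ha' => ?_)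
        rw [Function.update_of_ne (ne_of_mem_of_not_mem ha' ha)]
      by_cases hc : ∀ i, i ∉ a :: ws → x i = y i
      · rw [if_pos hc, if_pos, hP, List.map_cons, List.prod_cons]
        · ring
        · intro i hi
          by_cases hia : i = a
          · subst hia
            simp
          · rw [Function.update_of_ne hia]
            exact hc i (by simp [hia, hi])
      · rw [if_neg hc, if_neg, zero_mul]
        intro h'
        apply hc
        intro i hi
        have hia : i ≠ a := fun h => hi (h ▸ by simp)
        have := h' i fun h => hi (by simp [h])
        rwa [Function.update_of_ne hia] at this
    · intro bb _ hb
      simp only [extend_fin_one, wireEmb_apply, ih (List.nodup_cons.1 hws).2]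
      rw [if_neg, zero_mul]
      intro h'
      have := h' a ha
      rw [Function.update_self] at this
      exact hb this.symm
    · intro h
      exact absurd (Finset.mem_univ _) h

/-- **One Hadamard gate on every wire of a `k`-register is `H^{⊗k}`.** [cite: NielsenChuang2010, §1.4.4 eq. (1.50)] -/
theorem toMatrix_finRange_map_hOn (A : Language Bool) (k : ℕ) :
    (⟨(List.finRange k).map hOn⟩ : QCircuit cliffordT k).toMatrix A = hGateAll k := by
  ext x y
  rw [toMatrix_map_hOn A _ (List.nodup_finRange k), if_pos fun i hi => absurd (List.mem_finRange i) hi,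
    hGateAll_apply_eq_prod, Fin.prod_univ_def]

/-- The Hadamard layer on the sub-register embedded along `e`: one `H` on each wire `e j`.
[cite: NielsenChuang2010, §1.4.4] -/
def hLayerE (e : Fin k ↪ Fin N) : List (QGate cliffordT N) := (List.finRange k).map fun j => hOn (e j)

/-- The embedded Hadamard layer is the embedding of the full layer of the sub-register. [folklore] -/
theorem hLayerE_eq_embed (e : Fin k ↪ Fin N) :
    hLayerE e = (mapWires e (⟨(List.finRange k).map hOn⟩ : QCircuit cliffordT k)).gates := by
  simp [hLayerE, mapWires, hOn_embed]

/-- **The embedded Hadamard layer is `H^{⊗k}` placed on the sub-register.** [cite: NielsenChuang2010, §1.4.4 eq. (1.50)] -/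
theorem toMatrix_hLayerE (A : Language Bool) (e : Fin k ↪ Fin N) :
    (⟨hLayerE e⟩ : QCircuit cliffordT N).toMatrix A = placeGate e (hGateAll k) := by
  rw [hLayerE_eq_embed, show (⟨(mapWires e (⟨(List.finRange k).map hOn⟩ : QCircuit cliffordT k)).gates⟩ : QCircuit cliffordT N)
      = mapWires e (⟨(List.finRange k).map hOn⟩ : QCircuit cliffordT k) from rfl,
    toMatrix_mapWires, toMatrix_finRange_map_hOn]

/-- A placed operator on a basis state: `U_e |w⟩ = ∑_y U(y, w|_e) |w with e ↦ y⟩`. [cite: NielsenChuang2010, §4.3] -/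
theorem placeGate_mulVec_basisState (e : Fin k ↪ Fin N) (U : Matrix (QReg k) (QReg k) ℂ) (w : QReg N) :
    placeGate e U *ᵥ basisState w = ∑ y : QReg k, U y (w ∘ e) • basisState (Function.extend e y w) := by
  funext x
  rw [placeGate_mulVec_apply]
  simp only [Finset.sum_apply, Pi.smul_apply, smul_eq_mul, basisState_apply]
  have hA : ∀ z : QReg k, (Function.extend e z x = w) ↔ (z = w ∘ e ∧ ∀ i, i ∉ Set.range e → x i = w i) := by
    intro z
    constructor
    · intro h
      refine ⟨?_, fun i hi => ?_⟩
      · rw [← h, extend_comp_embedding]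
      · rw [← h, extend_apply_of_not_mem e _ _ hi]
    · rintro ⟨rfl, h⟩
      funext i
      by_cases hi : i ∈ Set.range e
      · obtain ⟨j, rfl⟩ := hi
        exact e.injective.extend_apply _ _ j
      · rw [extend_apply_of_not_mem e _ _ hi, h i hi]
  have hB : ∀ y : QReg k, (x = Function.extend e y w) ↔ (y = x ∘ e ∧ ∀ i, i ∉ Set.range e → x i = w i) := by
    intro y
    constructor
    · intro h
      refine ⟨?_, fun i hi => ?_⟩
      · rw [h, extend_comp_embedding]
      · rw [h, extend_apply_of_not_mem e _ _ hi]
    · rintro ⟨rfl, h⟩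
      funext i
      by_cases hi : i ∈ Set.range e
      · obtain ⟨j, rfl⟩ := hi
        exact (e.injective.extend_apply (x ∘ e) w j).symm
      · rw [extend_apply_of_not_mem e _ _ hi, h i hi]
  simp_rw [hA, hB]
  by_cases hag : ∀ i, i ∉ Set.range e → x i = w i
  · have hag' : (∀ i, i ∉ Set.range e → x i = w i) ↔ True := iff_true_intro hag
    simp only [hag', and_true, mul_ite, mul_one, mul_zero, Finset.sum_ite_eq', Finset.mem_univ, if_true]
  · have hag' : (∀ i, i ∉ Set.range e → x i = w i) ↔ False := iff_false_intro hag
    simp only [hag', and_false, if_false, mul_zero, Finset.sum_const_zero]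

end HLayer


/-! ### Binary increment: the carry identity -/

/-- The carry into bit `l` when incrementing `r`: all lower bits of `r` are `1`. [folklore] -/
def carry (r l : ℕ) : Bool := (List.range l).all fun j => r.testBit j

/-- `carry r 0 = 1`. [folklore] -/
@[simp] theorem carry_zero (r : ℕ) : carry r 0 = true := rfl

/-- `carry r (l+1) = bit₀(r) ∧ carry (r/2) l`. [folklore] -/
theorem carry_succ (r l : ℕ) : carry r (l + 1) = (r.testBit 0 && carry (r / 2) l) := by
  simp only [carry, List.range_succ_eq_map, List.all_cons, List.all_map]
  congr 1
  exact List.all_congr_of_forall_mem fun j _ => by simp [Nat.testBit_add_one]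

/-- **Bits of a successor**: `bit_l(r + 1) = bit_l(r) ⊕ carry_l(r)` (ripple-carry increment).
[Nielsen–Chuang 2010, §3.2.5] [folklore] -/
theorem testBit_succ_eq_xor_carry : ∀ (l r : ℕ), (r + 1).testBit l = (r.testBit l ^^ carry r l)
  | 0, r => by
    rw [carry_zero, Nat.testBit_zero, Nat.testBit_zero]
    rcases Nat.mod_two_eq_zero_or_one r with h | h <;> simp [Nat.add_mod, h]
  | l + 1, r => by
    rw [Nat.testBit_add_one, Nat.testBit_add_one, carry_succ, Nat.testBit_zero]
    rcases Nat.mod_two_eq_zero_or_one r with h | h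
    · have e : (r + 1) / 2 = r / 2 := by omega
      rw [e]; simp [h]
    · have e : (r + 1) / 2 = r / 2 + 1 := by omega
      rw [e, testBit_succ_eq_xor_carry l (r / 2)]; simp [h]

/-! ### The block layout -/

section Layout

variable (n L : ℕ)

/-- The half-selector qubit `h` (the top address qubit, number `n`). [cite: RazTalJACM2022, §2.2] -/
def hW : ℕ := n

/-- The phase-kick-back target qubit `t`. [cite: NielsenChuang2010, §6.1.1] -/
def tW : ℕ := n + 1

/-- The constant-`1` wire `o` (seed of the increments). [folklore] -/
def oW : ℕ := n + 2

/-- Bit `l` of the block-index register. [cite: RazTalJACM2022, App. A] -/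
def bW (l : ℕ) : ℕ := n + 3 + l

/-- Carry `l` of the `r`-th increment (a fresh ancilla; cf. Nielsen–Chuang 2010, §3.2.5). [folklore] -/
def kW (r l : ℕ) : ℕ := n + 3 + L + r * (L + 1) + l

/-- The number of wires of a block: `n + 1` address qubits, target, seed, `L` index bits and
`m (L + 1)` carries (`m = rtBlocks n` increments at most). [cite: RazTalJACM2022, App. A] -/
def Bsz : ℕ := n + 3 + L + rtBlocks n * (L + 1)

/-- A block has at least `n + 3` wires. [folklore] -/
theorem Bsz_pos : 0 < Bsz n L := by unfold Bsz; omega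

/-- The wires of a block as elements of `Fin (Bsz n L)` (reduction modulo `Bsz`, the identity below
`Bsz`). [folklore] -/
def foB : ℕ → Fin (Bsz n L) := finOf (Bsz n L) (Bsz_pos n L)

variable {n L}

/-- Index bits are below the carries. [folklore] -/
theorem bW_lt_kW {l : ℕ} (hl : l < L) (r l' : ℕ) : bW n l < kW n L r l' := by unfold bW kW; nlinarith

/-- Carries are injective in (round, position). [folklore] -/
theorem kW_inj {r l r' l' : ℕ} (hl : l ≤ L) (hl' : l' ≤ L) (h : kW n L r l = kW n L r' l') : r = r' ∧ l = l' := by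
  unfold kW at h
  have h1 : r * (L + 1) + l = r' * (L + 1) + l' := by omega
  have hr : r = r' := by nlinarith
  subst hr
  exact ⟨rfl, by omega⟩

/-- Carries of rounds `< m` fit in the block. [folklore] -/
theorem kW_lt_Bsz {r l : ℕ} (hr : r < rtBlocks n) (hl : l ≤ L) : kW n L r l < Bsz n L := by
  unfold kW Bsz
  have : r * (L + 1) + l < rtBlocks n * (L + 1) := by
    calc r * (L + 1) + l < r * (L + 1) + (L + 1) := by omega
      _ = (r + 1) * (L + 1) := by ring
      _ ≤ rtBlocks n * (L + 1) := Nat.mul_le_mul_right _ hr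
  omega

/-- Index bits fit in the block. [folklore] -/
theorem bW_lt_Bsz {l : ℕ} (hl : l < L) : bW n l < Bsz n L := by unfold bW Bsz; omega

end Layout

/-! ### The block program -/

section Program

variable (n L : ℕ)

/-- **The `r`-th increment of the index register** (ripple carry with fresh carries): seed the
carry chain from the constant wire, compute the carries `c_{l+1} = c_l ∧ b_l` by a Toffoli chain,
then flip `b_l ⊕= c_l`. [Nielsen–Chuang 2010, §3.2.5] [folklore] -/
def incrOps (r : ℕ) : List (ClOp ℕ) :=
  ClOp.cnot (oW n) (kW n L r 0) ::
    (clChain (kW n L r 0) ((List.range L).map (bW n)) ((List.range L).map fun l => kW n L r (l + 1)) ++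
      (List.range L).map fun l => ClOp.cnot (kW n L r l) (bW n l))

/-- **The classical prefix of block `i`**: set the seed wire to `1`, then increment the index
register `i` times, so that it holds `i` in binary. [cite: RazTalJACM2022, App. A] -/
def prefixOps (i : ℕ) : List (ClOp ℕ) := ClOp.not (oW n) :: (List.range i).flatMap (incrOps n L)

/-- The query wires: the `n + 1` address qubits, then the `L` index bits (so that the queried
string is `natBits (n+1) k ++ natBits L i = rtAddr n i k`). [cite: RazTalJACM2022, App. A] -/
def queryWires : List ℕ := List.range (n + 1) ++ (List.range L).map (bW n)

/-- **The quantum part of a block**: target to `|−⟩` (`X`, `H`), `H` on the `n + 1` address qubits,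
one oracle query, the mixing unitary `V = H_h · CH^{⊗n}` (controlled Hadamards on the low address
qubits controlled by the half selector, then `H` on the half selector). [cite: RazTalJACM2022, §2.2 and §6] -/
def quantOps : List (RtOp ℕ) :=
  [RtOp.cl (ClOp.not (tW n)), RtOp.had (tW n)] ++ (List.range (n + 1)).map RtOp.had ++
    [RtOp.oracle (queryWires n L) (tW n)] ++ (List.range n).map (RtOp.chad (hW n)) ++ [RtOp.had (hW n)]

/-- **The program of block `i`.** [cite: RazTalJACM2022, App. A] -/
def blockOps (i : ℕ) : List (RtOp ℕ) := (prefixOps n L i).map RtOp.cl ++ quantOps n L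

variable {n L}

/-- The wires of an increment. [folklore] -/
theorem mem_incrOps_wires {r : ℕ} {op : ClOp ℕ} (hop : op ∈ incrOps n L r) {w : ℕ} (hw : w ∈ wiresOf op) :
    w = oW n ∨ (∃ l, l < L ∧ w = bW n l) ∨ (∃ l, l ≤ L ∧ w = kW n L r l) := by
  simp only [incrOps, List.mem_cons, List.mem_append, List.mem_map, List.mem_range] at hop
  rcases hop with rfl | hop | ⟨l, hl, rfl⟩
  · simp only [mem_wiresOf, ClOp.target, ClOp.controls, List.mem_singleton] at hw
    rcases hw with rfl | rfl
    · exact Or.inr (Or.inr ⟨0, Nat.zero_le _, rfl⟩)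
    · exact Or.inl rfl
  · -- a link of the chain: `toffoli (kW r l) (bW l) (kW r (l+1))`
    have key : ∀ (l0 : ℕ) (ls as : List ℕ), op ∈ clChain (kW n L r l0) ls as →
        (∀ x ∈ ls, ∃ l, l < L ∧ x = bW n l) → (∀ x ∈ as, ∃ l, l ≤ L ∧ x = kW n L r l) → l0 ≤ L →
        w = oW n ∨ (∃ l, l < L ∧ w = bW n l) ∨ (∃ l, l ≤ L ∧ w = kW n L r l) := by
      intro l0 ls as hmem hls has hl0
      induction ls generalizing l0 as with
      | nil => simp at hmem
      | cons x ls ih =>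
        cases as with
        | nil => simp at hmem
        | cons a as =>
          rw [clChain_cons_cons, List.mem_cons] at hmem
          rcases hmem with rfl | hmem
          · simp only [mem_wiresOf, ClOp.target, ClOp.controls, List.mem_cons, List.not_mem_nil, or_false] at hw
            rcases hw with h | h | h
            · rw [h]; exact Or.inr (Or.inr (has a (by simp)))
            · exact Or.inr (Or.inr ⟨l0, hl0, h⟩)
            · rw [h]; exact Or.inr (Or.inl (hls x (by simp)))
          · obtain ⟨la, hla, rfl⟩ := has a (by simp)
            exact ih la as hmem (fun y hy => hls y (by simp [hy])) (fun y hy => has y (by simp [hy])) hla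
    refine key 0 _ _ hop (fun x hx => ?_) (fun x hx => ?_) (Nat.zero_le _)
    · simp only [List.mem_map, List.mem_range] at hx
      obtain ⟨l, hl, rfl⟩ := hx; exact ⟨l, hl, rfl⟩
    · simp only [List.mem_map, List.mem_range] at hx
      obtain ⟨l, hl, rfl⟩ := hx; exact ⟨l + 1, hl, rfl⟩
  · simp only [mem_wiresOf, ClOp.target, ClOp.controls, List.mem_singleton] at hw
    rcases hw with rfl | rfl
    · exact Or.inr (Or.inl ⟨l, hl, rfl⟩)
    · exact Or.inr (Or.inr ⟨l, hl.le, rfl⟩)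

/-- The wires of the prefix lie in `[n + 2, Bsz)`. [folklore] -/
theorem prefixOps_wires {i : ℕ} (hi : i ≤ rtBlocks n) {op : ClOp ℕ} (hop : op ∈ prefixOps n L i) {w : ℕ}
    (hw : w ∈ wiresOf op) : n + 2 ≤ w ∧ w < Bsz n L := by
  simp only [prefixOps, List.mem_cons, List.mem_flatMap, List.mem_range] at hop
  rcases hop with rfl | ⟨r, hr, hop⟩
  · simp only [mem_wiresOf, ClOp.target, ClOp.controls, List.not_mem_nil, or_false] at hw
    rw [hw]; unfold oW Bsz; omega
  · rcases mem_incrOps_wires hop hw with rfl | ⟨l, hl, rfl⟩ | ⟨l, hl, rfl⟩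
    · unfold oW Bsz; omega
    · exact ⟨by unfold bW; omega, bW_lt_Bsz hl⟩
    · exact ⟨by unfold kW; omega, kW_lt_Bsz (lt_of_lt_of_le hr hi) hl⟩

/-- Targets of the prefix are `≥ n + 2`. [folklore] -/
theorem prefixOps_target_ge {i : ℕ} {op : ClOp ℕ} (hop : op ∈ prefixOps n L i) : n + 2 ≤ op.target := by
  simp only [prefixOps, List.mem_cons, List.mem_flatMap, List.mem_range] at hop
  rcases hop with rfl | ⟨r, -, hop⟩
  · simp [ClOp.target, oW]
  · rcases mem_incrOps_wires hop (show op.target ∈ wiresOf op by simp) with h | ⟨l, -, h⟩ | ⟨l, -, h⟩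
    · rw [h]; unfold oW; omega
    · rw [h]; unfold bW; omega
    · rw [h]; unfold kW; omega

/-- The increments are well formed. [folklore] -/
theorem incrOps_wf (r : ℕ) : ∀ op ∈ incrOps n L r, op.WF := by
  intro op hop
  simp only [incrOps, List.mem_cons, List.mem_append, List.mem_map, List.mem_range] at hop
  rcases hop with rfl | hop | ⟨l, hl, rfl⟩
  · change oW n ≠ kW n L r 0; unfold oW kW; omega
  · refine wf_of_mem_clChain ?_ ?_ ?_ hop
    · refine (List.nodup_range.map_on ?_)
      intro a ha b hb h
      rw [List.mem_range] at ha hb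
      exact (kW_inj (by omega) (by omega) h).2 |> Nat.succ_injective
    · simp only [List.mem_map, List.mem_range, not_exists, not_and]
      intro l _ h
      exact absurd (kW_inj (Nat.zero_le _) (by omega) h.symm).2 (by omega)
    · intro x hx
      simp only [List.mem_map, List.mem_range] at hx
      obtain ⟨l, hl, rfl⟩ := hx
      refine ⟨?_, (bW_lt_kW hl r 0).ne⟩
      simp only [List.mem_map, List.mem_range, not_exists, not_and]
      intro l' _ h
      exact absurd h (bW_lt_kW hl r _).ne'
  · change kW n L r l ≠ bW n l
    exact (bW_lt_kW hl r l).ne'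

/-- The prefix is well formed. [folklore] -/
theorem prefixOps_wf (i : ℕ) : ∀ op ∈ prefixOps n L i, op.WF := by
  intro op hop
  simp only [prefixOps, List.mem_cons, List.mem_flatMap, List.mem_range] at hop
  rcases hop with rfl | ⟨r, -, hop⟩
  · trivial
  · exact incrOps_wf r op hop

/-- The query wires are the address qubits and the index bits. [folklore] -/
theorem mem_queryWires {w : ℕ} : w ∈ queryWires n L ↔ w < n + 1 ∨ ∃ l, l < L ∧ w = bW n l := by
  simp only [queryWires, List.mem_append, List.mem_range, List.mem_map]
  constructor
  · rintro (h | ⟨l, hl, rfl⟩)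
    · exact Or.inl h
    · exact Or.inr ⟨l, hl, rfl⟩
  · rintro (h | ⟨l, hl, rfl⟩)
    · exact Or.inl h
    · exact Or.inr ⟨l, hl, rfl⟩

/-- There are `n + 1 + L` query wires. [folklore] -/
@[simp] theorem length_queryWires : (queryWires n L).length = n + 1 + L := by simp [queryWires]

/-- The query wires together with the target are pairwise distinct. [folklore] -/
theorem nodup_queryWires_target : (queryWires n L ++ [tW n]).Nodup := by
  rw [List.nodup_append]
  refine ⟨?_, List.nodup_singleton _, ?_⟩
  · rw [queryWires, List.nodup_append]
    refine ⟨List.nodup_range, List.nodup_range.map_on fun a _ b _ h => by unfold bW at h; omega, ?_⟩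
    intro x hx y hy
    simp only [List.mem_range, List.mem_map] at hx hy
    obtain ⟨l, -, rfl⟩ := hy
    unfold bW; omega
  · intro x hx y hy
    simp only [List.mem_singleton] at hy
    subst hy
    rcases mem_queryWires.1 hx with h | ⟨l, -, rfl⟩
    · unfold tW; omega
    · unfold bW tW; omega

/-- The quantum part is well formed. [folklore] -/
theorem quantOps_wf : ∀ op ∈ quantOps n L, op.WF := by
  intro op hop
  simp only [quantOps, List.mem_append, List.mem_cons, List.mem_map, List.mem_range, List.not_mem_nil, or_false] at hop
  rcases hop with ((((rfl | rfl) | ⟨l, -, rfl⟩) | rfl) | ⟨l, hl, rfl⟩) | rfl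
  · trivial
  · trivial
  · trivial
  · exact nodup_queryWires_target
  · change hW n ≠ l; unfold hW; omega
  · trivial

/-- The wires of the quantum part: address, target, index bits. [folklore] -/
theorem quantOps_wires {op : RtOp ℕ} (hop : op ∈ quantOps n L) {w : ℕ} (hw : w ∈ op.wires) :
    w ≤ n + 1 ∨ ∃ l, l < L ∧ w = bW n l := by
  simp only [quantOps, List.mem_append, List.mem_cons, List.mem_map, List.mem_range, List.not_mem_nil, or_false] at hop
  rcases hop with ((((rfl | rfl) | ⟨l, hl, rfl⟩) | rfl) | ⟨l, hl, rfl⟩) | rfl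
  · simp only [RtOp.wires, mem_wiresOf, ClOp.target, ClOp.controls, List.not_mem_nil, or_false] at hw
    rw [hw]; exact Or.inl (by unfold tW; omega)
  · simp only [RtOp.wires, List.mem_singleton] at hw
    rw [hw]; exact Or.inl (by unfold tW; omega)
  · simp only [RtOp.wires, List.mem_singleton] at hw
    rw [hw]; exact Or.inl (by omega)
  · simp only [RtOp.wires, List.mem_append, List.mem_singleton] at hw
    rcases hw with hw | hw
    · rcases mem_queryWires.1 hw with h | h
      · exact Or.inl (by omega)
      · exact Or.inr h
    · rw [hw]; exact Or.inl (by unfold tW; omega)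
  · simp only [RtOp.wires, List.mem_cons, List.not_mem_nil, or_false] at hw
    rcases hw with h | h
    · rw [h]; exact Or.inl (by unfold hW; omega)
    · rw [h]; exact Or.inl (by omega)
  · simp only [RtOp.wires, List.mem_singleton] at hw
    rw [hw]; exact Or.inl (by unfold hW; omega)

/-- The block program is well formed. [folklore] -/
theorem blockOps_wf (i : ℕ) : ∀ op ∈ blockOps n L i, op.WF := by
  intro op hop
  simp only [blockOps, List.mem_append, List.mem_map] at hop
  rcases hop with ⟨op', hop', rfl⟩ | hop
  · exact prefixOps_wf i op' hop'
  · exact quantOps_wf op hop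

/-- The wires of the block program are below `Bsz`. [folklore] -/
theorem blockOps_lt {i : ℕ} (hi : i ≤ rtBlocks n) : ∀ op ∈ blockOps n L i, ∀ w ∈ op.wires, w < Bsz n L := by
  intro op hop w hw
  simp only [blockOps, List.mem_append, List.mem_map] at hop
  rcases hop with ⟨op', hop', rfl⟩ | hop
  · exact (prefixOps_wires hi hop' hw).2
  · rcases quantOps_wires hop hw with h | ⟨l, hl, rfl⟩
    · unfold Bsz; omega
    · exact bW_lt_Bsz hl

end Program

/-! ### Transport to `Fin N` -/

section FinOf

variable {N : ℕ} (hN : 0 < N)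

/-- Re-indexing an operation below `N` through `finOf` preserves well-formedness. [folklore] -/
theorem RtOp.WF.map_finOf {op : RtOp ℕ} (h : op.WF) (hlt : ∀ w ∈ op.wires, w < N) : (op.map (finOf N hN)).WF :=
  h.map_of_injOn fun a ha a' ha' e => by
    have := congrArg Fin.val e
    rwa [val_finOf_of_lt hN (hlt a ha), val_finOf_of_lt hN (hlt a' ha')] at this

/-- A program below `N` re-indexed through `finOf` is well formed. [folklore] -/
theorem wf_map_finOf_of {ops : List (RtOp ℕ)} (hwf : ∀ op ∈ ops, op.WF) (hlt : ∀ op ∈ ops, ∀ w ∈ op.wires, w < N) :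
    ∀ op ∈ ops.map (RtOp.map (finOf N hN)), op.WF := by
  intro op hop
  obtain ⟨op', hop', rfl⟩ := List.mem_map.1 hop
  exact (hwf op' hop').map_finOf hN (hlt op' hop')

end FinOf

/-- **The circuit of block `i`** on its own `Bsz n L` wires. [cite: RazTalJACM2022, App. A] -/
def Qloc (n L : ℕ) (i : Fin (rtBlocks n)) : QCircuit cliffordT (Bsz n L) :=
  ⟨RtOp.compileList ((blockOps n L i).map (RtOp.map (foB n L)))
    (wf_map_finOf_of (Bsz_pos n L) (blockOps_wf (n := n) (L := L) i) (blockOps_lt (le_of_lt i.isLt)))⟩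

/-! ### Semantics of the classical prefix -/

section Prefix

variable {n L : ℕ}

/-- The state of the index register and the carries after `r` increments. [folklore] -/
structure IncInv (n L r : ℕ) (w : ℕ → Bool) : Prop where
  /-- the seed wire holds `1` -/
  seed : w (oW n) = true
  /-- the index register holds `r` in binary -/
  bits : ∀ l, l < L → w (bW n l) = r.testBit l
  /-- the carries of the rounds `≥ r` are fresh -/
  fresh : ∀ r' l, r ≤ r' → l ≤ L → w (kW n L r' l) = false

/-- After setting the seed on the zero state, the invariant holds with `r = 0`. [folklore] -/
theorem incInv_zero : IncInv n L 0 ((ClOp.not (oW n)).eval fun _ => false) := by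
  refine ⟨by simp [ClOp.eval_not], fun l hl => ?_, fun r' l _ _ => ?_⟩
  · rw [ClOp.eval_not, Function.update_of_ne, Nat.zero_testBit]
    unfold bW oW; omega
  · rw [ClOp.eval_not, Function.update_of_ne]
    unfold kW oW; omega

/-- **One ripple-carry increment.** [Nielsen–Chuang 2010, §3.2.5] [folklore] -/
theorem incInv_step {r : ℕ} {w : ℕ → Bool} (hw : IncInv n L r w) : IncInv n L (r + 1) (clEval (incrOps n L r) w) := by
  -- stage 1: seed the chain
  set w₁ := (ClOp.cnot (oW n) (kW n L r 0)).eval w with hw₁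
  have h1seed : w₁ (oW n) = true := by
    rw [hw₁, ClOp.eval_cnot, Function.update_of_ne]; exacts [hw.seed, by unfold oW kW; omega]
  have h1k0 : w₁ (kW n L r 0) = true := by
    rw [hw₁, ClOp.eval_cnot, Function.update_self, hw.seed, hw.fresh r 0 le_rfl (Nat.zero_le _)]; rfl
  have h1off : ∀ p, p ≠ kW n L r 0 → w₁ p = w p := fun p hp => by
    rw [hw₁, ClOp.eval_cnot, Function.update_of_ne hp]
  have h1bits : ∀ l, l < L → w₁ (bW n l) = r.testBit l := fun l hl => by
    rw [h1off _ (bW_lt_kW hl r 0).ne, hw.bits l hl]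
  -- stage 2: the carry chain
  set lits := (List.range L).map (bW n) with hlits
  set ancs := (List.range L).map (fun l => kW n L r (l + 1)) with hancs
  set w₂ := clEval (clChain (kW n L r 0) lits ancs) w₁ with hw₂
  have hlen : ancs.length ≤ lits.length := by simp [hlits, hancs]
  have hnd : ancs.Nodup := List.nodup_range.map_on fun a ha b hb h => by
    rw [List.mem_range] at ha hb
    exact Nat.succ_injective (kW_inj (by omega) (by omega) h).2
  have hdisj : ∀ x ∈ lits, x ∉ ancs := by
    intro x hx hmem
    simp only [hlits, hancs, List.mem_map, List.mem_range] at hx hmem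
    obtain ⟨l, hl, rfl⟩ := hx
    obtain ⟨l', -, h⟩ := hmem
    exact absurd h (bW_lt_kW hl r _).ne'
  have hz : ∀ a ∈ ancs, w₁ a = false := by
    intro a ha
    simp only [hancs, List.mem_map, List.mem_range] at ha
    obtain ⟨l, hl, rfl⟩ := ha
    rw [h1off _ (fun h => by have := (kW_inj (by omega) (Nat.zero_le _) h).2; omega)]
    exact hw.fresh r (l + 1) le_rfl (by omega)
  have h2carry : ∀ l, l ≤ L → w₂ (kW n L r l) = carry r l := by
    intro l hl
    rcases l with _ | j
    · rw [hw₂, clEval_clChain_of_not_mem, h1k0, carry_zero]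
      simp only [hancs, List.mem_map, List.mem_range, not_exists, not_and]
      intro x _ h
      have := (kW_inj (by omega) (Nat.zero_le _) h).2; omega
    · have hj : j < ancs.length := by simp [hancs]; omega
      have hget : ancs[j] = kW n L r (j + 1) := by simp [hancs]
      rw [← hget, hw₂, clEval_clChain_getElem _ lits ancs w₁ hlen hnd hdisj hz j hj, h1k0, Bool.true_and]
      have htake : lits.take (j + 1) = (List.range (j + 1)).map (bW n) := by
        rw [hlits, ← List.map_take, List.take_range, min_eq_left (by omega)]
      rw [htake, carry, List.all_map]
      refine List.all_congr_of_forall_mem fun x hx => ?_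
      rw [List.mem_range] at hx
      exact h1bits x (by omega)
  have h2off : ∀ p, (∀ l, l < L → p ≠ kW n L r (l + 1)) → w₂ p = w₁ p := fun p hp => by
    rw [hw₂, clEval_clChain_of_not_mem]
    simp only [hancs, List.mem_map, List.mem_range, not_exists, not_and]
    exact fun l hl h => hp l hl h.symm
  have h2bits : ∀ l, l < L → w₂ (bW n l) = r.testBit l := fun l hl => by
    rw [h2off _ fun l' _ h => absurd h (bW_lt_kW hl r _).ne, h1bits l hl]
  -- stage 3: flip the bits by the carries
  set ops₃ := (List.range L).map (fun l => ClOp.cnot (kW n L r l) (bW n l)) with hops₃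
  have h3disj : ∀ op ∈ ops₃, ∀ op' ∈ ops₃, op'.target ∉ op.controls := by
    intro op hop op' hop'
    simp only [hops₃, List.mem_map, List.mem_range] at hop hop'
    obtain ⟨l, hl, rfl⟩ := hop
    obtain ⟨l', hl', rfl⟩ := hop'
    simp only [ClOp.target, ClOp.controls, List.mem_singleton]
    exact (bW_lt_kW hl' r l).ne
  have h3nd : (ops₃.map ClOp.target).Nodup := by
    rw [hops₃, List.map_map]
    exact List.nodup_range.map_on fun a _ b _ h => by simp only [Function.comp_apply, ClOp.target] at h; unfold bW at h; omega
  have h3bits : ∀ l, l < L → clEval ops₃ w₂ (bW n l) = (r + 1).testBit l := by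
    intro l hl
    have hop : ClOp.cnot (kW n L r l) (bW n l) ∈ ops₃ := by
      rw [hops₃]; exact List.mem_map.2 ⟨l, List.mem_range.2 hl, rfl⟩
    have := clEval_apply_target_of_nodup ops₃ h3disj h3nd w₂ hop
    simp only [ClOp.target, ClOp.guard] at this
    rw [this, h2bits l hl, h2carry l hl.le, testBit_succ_eq_xor_carry]
  have h3off : ∀ p, (∀ l, l < L → p ≠ bW n l) → clEval ops₃ w₂ p = w₂ p := fun p hp =>
    clEval_apply_of_forall_target_ne ops₃ w₂ fun op hop e => by
      simp only [hops₃, List.mem_map, List.mem_range] at hop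
      obtain ⟨l, hl, rfl⟩ := hop
      exact hp l hl e.symm
  -- assemble
  have hrun : clEval (incrOps n L r) w = clEval ops₃ w₂ := by
    rw [incrOps, clEval_cons, clEval_append]
  rw [hrun]
  refine ⟨?_, h3bits, fun r' l hr' hl => ?_⟩
  · rw [h3off _ fun l hl h => by unfold oW bW at h; omega, h2off _ fun l hl h => by unfold oW kW at h; omega, h1seed]
  · rw [h3off _ fun l' hl' h => absurd h (bW_lt_kW hl' r' l).ne',
      h2off _ fun l' hl' h => by have := (kW_inj hl (by omega) h).1; omega,
      h1off _ fun h => by have := (kW_inj hl (Nat.zero_le _) h).1; omega]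
    exact hw.fresh r' l (by omega) hl

/-- **The classical prefix writes `i` in binary on the index register** (and `1` on the seed,
garbage on the carries of the rounds `< i`, `0` on the other carries). [cite: RazTalJACM2022, App. A] -/
theorem incInv_prefixOps (i : ℕ) : IncInv n L i (clEval (prefixOps n L i) fun _ => false) := by
  induction i with
  | zero => simpa [prefixOps] using (incInv_zero (n := n) (L := L))
  | succ i ih =>
    have e : prefixOps n L (i + 1) = prefixOps n L i ++ incrOps n L i := by
      simp [prefixOps, List.range_succ, List.flatMap_append]
    rw [e, clEval_append]
    exact incInv_step ih

/-- The prefix does not touch the wires below `n + 2` (address qubits and target). [folklore] -/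
theorem clEval_prefixOps_of_lt {i p : ℕ} (hp : p < n + 2) (w : ℕ → Bool) :
    clEval (prefixOps n L i) w p = w p :=
  clEval_apply_of_forall_target_ne _ _ fun op hop e => by
    have := prefixOps_target_ge hop; omega

end Prefix


/-! ### The quantum part: wires and configurations -/

section Quantum

variable {n L : ℕ}

/-- `(List.range k).map f` as a map over `Fin k`. [folklore] -/
theorem map_range_eq_map_finRange {α : Type*} (k : ℕ) (f : ℕ → α) :
    (List.range k).map f = (List.finRange k).map fun j : Fin k => f j.val := by
  rw [← List.ofFn_eq_map, List.ofFn_eq_pmap, List.pmap_eq_map]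

variable (n L)

/-- The address register `a₀, …, a_n` (wire `l` is address qubit `l`; `a_n` is the half selector).
[cite: RazTalJACM2022, §2.2] -/
def aEmb : Fin (n + 1) ↪ Fin (Bsz n L) :=
  ⟨fun j => foB n L j, fun j j' h => by
    have := congrArg Fin.val h
    simp only [foB, val_finOf_of_lt _ (show (j : ℕ) < Bsz n L by unfold Bsz; omega),
      val_finOf_of_lt _ (show (j' : ℕ) < Bsz n L by unfold Bsz; omega)] at this
    exact Fin.ext this⟩

/-- The low address register `a₀, …, a_{n-1}` (the targets of the controlled Hadamards). [cite: RazTalJACM2022, §2.2] -/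
def aEmb' : Fin n ↪ Fin (Bsz n L) :=
  ⟨fun j => foB n L j, fun j j' h => by
    have := congrArg Fin.val h
    simp only [foB, val_finOf_of_lt _ (show (j : ℕ) < Bsz n L by unfold Bsz; omega),
      val_finOf_of_lt _ (show (j' : ℕ) < Bsz n L by unfold Bsz; omega)] at this
    exact Fin.ext this⟩

/-- The half-selector qubit. [cite: RazTalJACM2022, §2.2] -/
def fh : Fin (Bsz n L) := foB n L (hW n)

/-- The target qubit. [cite: NielsenChuang2010, §6.1.1] -/
def ft : Fin (Bsz n L) := foB n L (tW n)

variable {n L}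

/-- Values of `foB` below `Bsz`. [folklore] -/
theorem val_foB {p : ℕ} (hp : p < Bsz n L) : (foB n L p : ℕ) = p := val_finOf_of_lt _ hp

/-- `aEmb j` is wire `j`. [folklore] -/
@[simp] theorem val_aEmb (j : Fin (n + 1)) : (aEmb n L j : ℕ) = j := val_foB (by unfold Bsz; omega)

/-- `aEmb' j` is wire `j`. [folklore] -/
@[simp] theorem val_aEmb' (j : Fin n) : (aEmb' n L j : ℕ) = j := val_foB (by unfold Bsz; omega)

/-- The half selector is wire `n`. [folklore] -/
@[simp] theorem val_fh : (fh n L : ℕ) = n := val_foB (by unfold hW Bsz; omega)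

/-- The target is wire `n + 1`. [folklore] -/
@[simp] theorem val_ft : (ft n L : ℕ) = n + 1 := val_foB (by unfold tW Bsz; omega)

/-- The half selector is the last address qubit. [folklore] -/
theorem aEmb_last : aEmb n L (Fin.last n) = fh n L := Fin.ext (by simp)

/-- The low address qubits are the first address qubits. [folklore] -/
theorem aEmb_castSucc (j : Fin n) : aEmb n L j.castSucc = aEmb' n L j := Fin.ext (by simp)

/-- The target is not an address qubit. [folklore] -/
theorem ft_not_mem_range_aEmb : ft n L ∉ Set.range (aEmb n L) := by
  rintro ⟨j, hj⟩
  have := congrArg Fin.val hj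
  simp at this
  omega

variable (c : QReg (Bsz n L))

/-- **Configurations**: the basis label `c` with the address register overwritten by `y` and the
target by `tb`. [folklore] -/
def cfg (y : Fin (n + 1) → Bool) (tb : Bool) : QReg (Bsz n L) :=
  Function.extend (aEmb n L) y (Function.update c (ft n L) tb)

/-- The address register of a configuration. [folklore] -/
@[simp] theorem cfg_apply_aEmb (y : Fin (n + 1) → Bool) (tb : Bool) (j : Fin (n + 1)) :
    cfg c y tb (aEmb n L j) = y j :=
  (aEmb n L).injective.extend_apply _ _ j

/-- The address register of a configuration, as a function. [folklore] -/
@[simp] theorem cfg_comp_aEmb (y : Fin (n + 1) → Bool) (tb : Bool) : cfg c y tb ∘ aEmb n L = y :=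
  funext fun j => cfg_apply_aEmb c y tb j

/-- The target of a configuration. [folklore] -/
@[simp] theorem cfg_apply_ft (y : Fin (n + 1) → Bool) (tb : Bool) : cfg c y tb (ft n L) = tb := by
  unfold cfg
  rw [extend_apply_of_not_mem _ _ _ ft_not_mem_range_aEmb, Function.update_self]

/-- The other wires of a configuration are those of `c`. [folklore] -/
theorem cfg_apply_of_not_mem (y : Fin (n + 1) → Bool) (tb : Bool) {p : Fin (Bsz n L)}
    (hp : p ∉ Set.range (aEmb n L)) (hpt : p ≠ ft n L) : cfg c y tb p = c p := by
  unfold cfg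
  rw [extend_apply_of_not_mem _ _ _ hp, Function.update_of_ne hpt]

/-- Wires `≥ n + 2` are neither address qubits nor the target. [folklore] -/
theorem cfg_apply_of_le (y : Fin (n + 1) → Bool) (tb : Bool) {p : Fin (Bsz n L)} (hp : n + 2 ≤ (p : ℕ)) :
    cfg c y tb p = c p := by
  refine cfg_apply_of_not_mem c y tb ?_ ?_
  · rintro ⟨j, rfl⟩; simp at hp; omega
  · intro h; rw [h] at hp; simp at hp

/-- Overwriting the address register of a configuration. [folklore] -/
theorem extend_aEmb_cfg (y y' : Fin (n + 1) → Bool) (tb : Bool) :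
    Function.extend (aEmb n L) y' (cfg c y tb) = cfg c y' tb := by
  funext p
  by_cases hp : p ∈ Set.range (aEmb n L)
  · obtain ⟨j, rfl⟩ := hp
    rw [(aEmb n L).injective.extend_apply, cfg_apply_aEmb]
  · unfold cfg
    rw [extend_apply_of_not_mem _ _ _ hp, extend_apply_of_not_mem _ _ _ hp, extend_apply_of_not_mem _ _ _ hp]

/-- Updating one address qubit of a configuration. [folklore] -/
theorem update_cfg_aEmb (y : Fin (n + 1) → Bool) (tb : Bool) (j : Fin (n + 1)) (b : Bool) :
    Function.update (cfg c y tb) (aEmb n L j) b = cfg c (Function.update y j b) tb := by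
  funext p
  by_cases hp : p ∈ Set.range (aEmb n L)
  · obtain ⟨j', rfl⟩ := hp
    rw [cfg_apply_aEmb]
    by_cases hjj : j' = j
    · subst hjj; simp
    · rw [Function.update_of_ne (fun h => hjj ((aEmb n L).injective h)), Function.update_of_ne hjj, cfg_apply_aEmb]
  · rw [Function.update_of_ne (fun h => hp ⟨j, h.symm⟩)]
    unfold cfg
    rw [extend_apply_of_not_mem _ _ _ hp, extend_apply_of_not_mem _ _ _ hp]

/-- Updating the target of a configuration. [folklore] -/
theorem update_cfg_ft (y : Fin (n + 1) → Bool) (tb b : Bool) :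
    Function.update (cfg c y tb) (ft n L) b = cfg c y b := by
  funext p
  by_cases hpt : p = ft n L
  · subst hpt; simp
  · rw [Function.update_of_ne hpt]
    by_cases hp : p ∈ Set.range (aEmb n L)
    · obtain ⟨j, rfl⟩ := hp; simp
    · rw [cfg_apply_of_not_mem c _ _ hp hpt, cfg_apply_of_not_mem c _ _ hp hpt]

/-- The low address register of a configuration `snoc u b`. [folklore] -/
theorem cfg_snoc_comp_aEmb' (u : Fin n → Bool) (b tb : Bool) :
    cfg c (Fin.snoc u b) tb ∘ aEmb' n L = u := by
  funext j
  simp only [Function.comp_apply, ← aEmb_castSucc, cfg_apply_aEmb, Fin.snoc_castSucc]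

/-- Overwriting the low address register of a configuration `snoc u b`. [folklore] -/
theorem extend_aEmb'_cfg_snoc (u u' : Fin n → Bool) (b tb : Bool) :
    Function.extend (aEmb' n L) u' (cfg c (Fin.snoc u b) tb) = cfg c (Fin.snoc u' b) tb := by
  funext p
  by_cases hp : p ∈ Set.range (aEmb' n L)
  · obtain ⟨j, rfl⟩ := hp
    rw [(aEmb' n L).injective.extend_apply, ← aEmb_castSucc, cfg_apply_aEmb, Fin.snoc_castSucc]
  · rw [extend_apply_of_not_mem _ _ _ hp]
    by_cases hp' : p ∈ Set.range (aEmb n L)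
    · obtain ⟨j, rfl⟩ := hp'
      rcases Fin.eq_castSucc_or_eq_last j with ⟨j, rfl⟩ | rfl
      · exact absurd ⟨j, (aEmb_castSucc j).symm⟩ hp
      · rw [cfg_apply_aEmb, cfg_apply_aEmb, Fin.snoc_last, Fin.snoc_last]
    · unfold cfg
      rw [extend_apply_of_not_mem _ _ _ hp', extend_apply_of_not_mem _ _ _ hp']

/-- Configurations are determined by their address register and target. [folklore] -/
theorem cfg_injective {y y' : Fin (n + 1) → Bool} {tb tb' : Bool} (h : cfg c y tb = cfg c y' tb') :
    y = y' ∧ tb = tb' := by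
  constructor
  · rw [← cfg_comp_aEmb c y tb, h, cfg_comp_aEmb]
  · rw [← cfg_apply_ft c y tb, h, cfg_apply_ft]

/-- The half selector of a configuration is the last address bit. [folklore] -/
@[simp] theorem cfg_apply_fh (y : Fin (n + 1) → Bool) (tb : Bool) : cfg c y tb (fh n L) = y (Fin.last n) := by
  rw [← aEmb_last, cfg_apply_aEmb]

/-- **The target in `|−⟩`**: `D y = |cfg y 0⟩ − |cfg y 1⟩`. [cite: NielsenChuang2010, §6.1.1 Eq. (6.4)] -/
def Dvec (y : Fin (n + 1) → Bool) : QReg (Bsz n L) → ℂ :=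
  basisState (cfg c y false) - basisState (cfg c y true)

/-- **Superpositions of the address register with the target in `|−⟩`**: `∑_y β(y) D y`. [folklore] -/
def dState (β : (Fin (n + 1) → Bool) → ℂ) : QReg (Bsz n L) → ℂ :=
  ∑ y, β y • Dvec c y

/-- The amplitudes of `dState β`: `β(y)` at `cfg y 0`, `−β(y)` at `cfg y 1`, `0` elsewhere. [folklore] -/
theorem dState_apply (β : (Fin (n + 1) → Bool) → ℂ) (z : QReg (Bsz n L)) :
    dState c β z = ∑ y, ((if z = cfg c y false then β y else 0) - (if z = cfg c y true then β y else 0)) := by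
  simp only [dState, Dvec, Finset.sum_apply, Pi.smul_apply, Pi.sub_apply, basisState_apply, smul_eq_mul,
    mul_sub, mul_ite, mul_one, mul_zero]

/-- The amplitude of `dState β` at a configuration. [folklore] -/
theorem dState_apply_cfg (β : (Fin (n + 1) → Bool) → ℂ) (y : Fin (n + 1) → Bool) (tb : Bool) :
    dState c β (cfg c y tb) = if tb then -β y else β y := by
  rw [dState_apply]
  cases tb
  · rw [Finset.sum_eq_single y]
    · rw [if_pos rfl, if_neg (fun h => Bool.false_ne_true (cfg_injective c h).2)]; simp
    · intro y' _ hy'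
      rw [if_neg (fun h => hy' (cfg_injective c h).1.symm), if_neg (fun h => Bool.false_ne_true (cfg_injective c h).2)]
      simp
    · intro h; exact absurd (Finset.mem_univ _) h
  · rw [Finset.sum_eq_single y]
    · rw [if_neg (fun h => Bool.false_ne_true (cfg_injective c h).2.symm), if_pos rfl]; simp
    · intro y' _ hy'
      rw [if_neg (fun h => Bool.false_ne_true (cfg_injective c h).2.symm), if_neg (fun h => hy' (cfg_injective c h).1.symm)]
      simp
    · intro h; exact absurd (Finset.mem_univ _) h

/-- `dState β` vanishes off the configurations. [folklore] -/
theorem dState_apply_of_ne (β : (Fin (n + 1) → Bool) → ℂ) {z : QReg (Bsz n L)} (hz : ∀ y tb, z ≠ cfg c y tb) :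
    dState c β z = 0 := by
  rw [dState_apply]
  exact Finset.sum_eq_zero fun y _ => by rw [if_neg (hz y false), if_neg (hz y true), sub_zero]

/-- `dState` is additive. [folklore] -/
theorem dState_add (β β' : (Fin (n + 1) → Bool) → ℂ) : dState c (β + β') = dState c β + dState c β' := by
  unfold dState
  rw [← Finset.sum_add_distrib]
  exact Finset.sum_congr rfl fun y _ => by rw [Pi.add_apply, add_smul]

/-! ### The quantum part: the stages -/

variable (A : Language Bool)

/-- The sign `(−1)^b` as a complex number. [folklore] -/
def sgnC (b : Bool) : ℂ := if b then -1 else 1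

/-- `sgnC` is the real character `sgn`. [folklore] -/
theorem sgnC_eq_sgn (b : Bool) : sgnC b = (sgn b : ℂ) := by cases b <;> simp [sgnC, sgn]

variable (hc : ∀ p : Fin (Bsz n L), (p : ℕ) < n + 2 → c p = false)
include hc

/-- With `c` vanishing on the address register and the target, `c = cfg 0 0`. [folklore] -/
theorem cfg_zero_false : cfg c (fun _ => false) false = c := by
  funext p
  by_cases hp : p ∈ Set.range (aEmb n L)
  · obtain ⟨j, rfl⟩ := hp
    rw [cfg_apply_aEmb, hc _ (by simp; omega)]
  · by_cases hpt : p = ft n L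
    · subst hpt; rw [cfg_apply_ft, hc _ (by simp)]
    · exact cfg_apply_of_not_mem c _ _ hp hpt

omit hc in
/-- **Stage 1** (`X` on the target): `|cfg y 0⟩ ↦ |cfg y 1⟩`. [cite: NielsenChuang2010, §4.2 Ex. 4.18] -/
theorem xWord_ft_mulVec_cfg (y : Fin (n + 1) → Bool) :
    (⟨xWord (ft n L)⟩ : QCircuit cliffordT (Bsz n L)).toMatrix A *ᵥ basisState (cfg c y false) =
      basisState (cfg c y true) := by
  rw [xWord_mulVec_basisState, cfg_apply_ft, Bool.not_false, update_cfg_ft]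

omit hc in
/-- **Stage 2** (`H` on the target): `|cfg y 1⟩ ↦ (1/√2) D y`. [cite: NielsenChuang2010, §1.3.1] -/
theorem hOn_ft_mulVec_cfg (y : Fin (n + 1) → Bool) :
    (hOn (ft n L)).toMatrix A *ᵥ basisState (cfg c y true) = invSqrt2 • Dvec c y := by
  rw [hOn_mulVec_basisState', cfg_apply_ft, update_cfg_ft, update_cfg_ft, Dvec]
  simp [sub_eq_add_neg]

omit hc in
/-- `H^{⊗(n+1)}` has first column `2^{-(n+1)/2}`. [cite: NielsenChuang2010, §1.4.4] -/
theorem hGateAll_apply_zero (k : ℕ) (y : QReg k) : hGateAll k y (fun _ => false) = invSqrt2 ^ k := by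
  rw [hGateAll, Matrix.of_apply]
  have h0 : (Finset.univ.filter fun i : Fin k => y i = true ∧ (fun _ : Fin k => false) i = true).card = 0 := by
    rw [Finset.card_eq_zero, Finset.filter_eq_empty_iff]; simp
  rw [h0, pow_zero, mul_one]
  simp [invSqrt2]

omit hc in
/-- **Stage 3** (`H` on the address register): `D 0 ↦ 2^{-(n+1)/2} ∑_y D y = 2^{-(n+1)/2} dState 1`.
[cite: NielsenChuang2010, §1.4.4] -/
theorem hLayer_mulVec_Dvec_zero :
    (⟨hLayerE (aEmb n L)⟩ : QCircuit cliffordT (Bsz n L)).toMatrix A *ᵥ Dvec c (fun _ => false) =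
      invSqrt2 ^ (n + 1) • dState c (fun _ => 1) := by
  rw [toMatrix_hLayerE, Dvec, Matrix.mulVec_sub, placeGate_mulVec_basisState, placeGate_mulVec_basisState]
  simp only [cfg_comp_aEmb, hGateAll_apply_zero, extend_aEmb_cfg]
  rw [dState, Finset.smul_sum, ← Finset.sum_sub_distrib]
  exact Finset.sum_congr rfl fun y _ => by simp only [Dvec, one_smul, smul_sub]

omit hc in
/-- The query string of the oracle gate at a configuration: the address bits, then the index bits
of `c`. [cite: NielsenChuang2010, §6.1.1] -/
theorem queryOf_cfg (y : Fin (n + 1) → Bool) (tb : Bool)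
    (h : (((queryWires n L).map (foB n L)) ++ [ft n L]).Nodup) :
    queryOf (oracleEmb ((queryWires n L).map (foB n L)) (ft n L) h) (cfg c y tb) =
      List.ofFn y ++ (List.range L).map fun l => c (foB n L (bW n l)) := by
  unfold queryOf
  have e1 : (List.ofFn fun j : Fin ((queryWires n L).map (foB n L)).length =>
      cfg c y tb (oracleEmb ((queryWires n L).map (foB n L)) (ft n L) h j.castSucc)) =
      List.ofFn fun j : Fin ((queryWires n L).map (foB n L)).length => cfg c y tb (((queryWires n L).map (foB n L))[j.val]) := by
    congr 1
    funext j
    rw [oracleEmb_castSucc]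
  have e2 : ((queryWires n L).map (foB n L)).map (cfg c y tb) =
      List.ofFn y ++ (List.range L).map fun l => c (foB n L (bW n l)) := by
    rw [queryWires, List.map_append, List.map_append, List.map_map, List.map_map, List.map_map]
    congr 1
    · rw [map_range_eq_map_finRange, List.ofFn_eq_map]
      refine List.map_congr_left fun j _ => ?_
      exact cfg_apply_aEmb c y tb j
    · refine List.map_congr_left fun l hl => ?_
      rw [List.mem_range] at hl
      simp only [Function.comp_apply]
      exact cfg_apply_of_le c y tb (by rw [val_foB (bW_lt_Bsz hl)]; unfold bW; omega)
  rw [e1, List.ofFn_getElem_eq_map, e2]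

/-- The answer bit of the query of block content `c` at address `y`. [cite: RazTalJACM2022, App. A] -/
def chi (y : Fin (n + 1) → Bool) : Bool :=
  A.boolIndicator (List.ofFn y ++ (List.range L).map fun l => c (foB n L (bW n l)))

omit hc in
/-- **Stage 4** (the oracle query, phase kick-back): `D y ↦ (−1)^{χ(y)} D y`.
[cite: NielsenChuang2010, §6.1.1 Eq. (6.4)] -/
theorem oracle_mulVec_Dvec (y : Fin (n + 1) → Bool) (h : (((queryWires n L).map (foB n L)) ++ [ft n L]).Nodup) :
    (QGate.oracle ((queryWires n L).map (foB n L)).length (oracleEmb ((queryWires n L).map (foB n L)) (ft n L) h) :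
        QGate cliffordT (Bsz n L)).toMatrix A *ᵥ Dvec c y = sgnC (chi c A y) • Dvec c y := by
  have key : ∀ tb, (QGate.oracle ((queryWires n L).map (foB n L)).length
      (oracleEmb ((queryWires n L).map (foB n L)) (ft n L) h) : QGate cliffordT (Bsz n L)).toMatrix A *ᵥ
        basisState (cfg c y tb) = basisState (cfg c y (tb ^^ chi c A y)) := by
    intro tb
    rw [QGate.toMatrix_oracle, placeGate_oracleGate_mulVec_basisState, oracleTarget, oracleEmb_last, queryOf_cfg,
      cfg_apply_ft, update_cfg_ft]
    rfl
  rw [Dvec, Matrix.mulVec_sub, key, key]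
  cases chi c A y <;> simp [sgnC]

omit hc in
/-- **Stage 4 on superpositions**: `dState β ↦ dState (χ̂ · β)`. [cite: NielsenChuang2010, §6.1.1 Eq. (6.4)] -/
theorem oracle_mulVec_dState (β : (Fin (n + 1) → Bool) → ℂ) (h : (((queryWires n L).map (foB n L)) ++ [ft n L]).Nodup) :
    (QGate.oracle ((queryWires n L).map (foB n L)).length (oracleEmb ((queryWires n L).map (foB n L)) (ft n L) h) :
        QGate cliffordT (Bsz n L)).toMatrix A *ᵥ dState c β = dState c (fun y => sgnC (chi c A y) * β y) := by
  unfold dState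
  rw [Matrix.mulVec_sum]
  exact Finset.sum_congr rfl fun y _ => by rw [Matrix.mulVec_smul, oracle_mulVec_Dvec, smul_smul, mul_comm]


omit hc in
/-- Sums over `{0,1}^{n+1}` split along the last bit. [folklore] -/
theorem sum_eq_sum_snoc {M : Type*} [AddCommMonoid M] (g : (Fin (n + 1) → Bool) → M) :
    ∑ y, g y = ∑ u : Fin n → Bool, (g (Fin.snoc u false) + g (Fin.snoc u true)) := by
  rw [← Fintype.sum_equiv (Fin.snocEquiv fun _ => Bool) (fun p => g (Fin.snoc p.2 p.1)) g (fun p => rfl),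
    Fintype.sum_prod_type, Fintype.sum_bool, ← Finset.sum_add_distrib]
  exact Finset.sum_congr rfl fun u _ => add_comm _ _

omit hc in
/-- A Hadamard gate on a state vector, pointwise: `(H_i ψ)(x) = (ψ(x[i↦0]) + (−1)^{x_i} ψ(x[i↦1]))/√2`.
[cite: NielsenChuang2010, §1.3.1] -/
theorem hOn_mulVec_apply {N : ℕ} (i : Fin N) (ψ : QReg N → ℂ) (x : QReg N) :
    ((hOn i).toMatrix A *ᵥ ψ) x =
      invSqrt2 * (ψ (Function.update x i false) + sgnC (x i) * ψ (Function.update x i true)) := by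
  rw [hOn_toMatrix, placeGate_mulVec_apply, sum_qReg_one, Fintype.sum_bool, extend_fin_one, extend_fin_one]
  simp only [wireEmb_apply, hGate_eq_mk2, mk2_apply, Function.comp_apply]
  rcases Bool.eq_false_or_eq_true (x i) with hx | hx <;> simp [hx, sgnC] <;> ring

omit hc in
/-- Updating the half selector of a configuration. [folklore] -/
theorem update_cfg_fh (y : Fin (n + 1) → Bool) (tb b : Bool) :
    Function.update (cfg c y tb) (fh n L) b = cfg c (Function.update y (Fin.last n) b) tb := by
  rw [← aEmb_last, update_cfg_aEmb]

omit hc in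
/-- A label that is not a configuration stays so after updating the half selector. [folklore] -/
theorem update_fh_ne_cfg {z : QReg (Bsz n L)} (hz : ∀ y tb, z ≠ cfg c y tb) (b : Bool) :
    ∀ y tb, Function.update z (fh n L) b ≠ cfg c y tb := by
  intro y tb h
  apply hz (Function.update y (Fin.last n) (z (fh n L))) tb
  have e := congrArg (fun w => Function.update w (fh n L) (z (fh n L))) h
  simp only [Function.update_idem, Function.update_eq_self] at e
  rw [update_cfg_fh] at e
  exact e

/-- **The mixing map of stage 6** (`H` on the half selector) on the amplitudes:
`β ↦ (y ↦ (β(y[h↦0]) + (−1)^{y_h} β(y[h↦1]))/√2)`. [cite: RazTalJACM2022, §2.2] -/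
def Th (β : (Fin (n + 1) → Bool) → ℂ) (y : Fin (n + 1) → Bool) : ℂ :=
  invSqrt2 * (β (Function.update y (Fin.last n) false) + sgnC (y (Fin.last n)) * β (Function.update y (Fin.last n) true))

omit hc in
/-- **Stage 6** (`H` on the half selector): `dState β ↦ dState (Th β)`. [cite: RazTalJACM2022, §2.2] -/
theorem hOn_fh_mulVec_dState (β : (Fin (n + 1) → Bool) → ℂ) :
    (hOn (fh n L)).toMatrix A *ᵥ dState c β = dState c (Th β) := by
  funext z
  rw [hOn_mulVec_apply]
  by_cases hz : ∃ y tb, z = cfg c y tb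
  · obtain ⟨y, tb, rfl⟩ := hz
    rw [update_cfg_fh, update_cfg_fh, dState_apply_cfg, dState_apply_cfg, dState_apply_cfg, cfg_apply_fh, Th]
    cases tb
    · simp
    · simp; ring
  · push Not at hz
    rw [dState_apply_of_ne c _ hz, dState_apply_of_ne c _ (update_fh_ne_cfg c hz false),
      dState_apply_of_ne c _ (update_fh_ne_cfg c hz true)]
    simp

/-- **The mixing map of stage 5** (controlled `H^{⊗n}` on the low address qubits, control = half
selector) on the amplitudes: on `y_h = 1`, `β ↦ ∑_u ⟨y_{low}|H^{⊗n}|u⟩ β(u, 1)`; identity on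
`y_h = 0`. [cite: RazTalJACM2022, §2.2] -/
def Tch (β : (Fin (n + 1) → Bool) → ℂ) (y : Fin (n + 1) → Bool) : ℂ :=
  if y (Fin.last n) = true then ∑ u, hGateAll n (Fin.init y) u * β (Fin.snoc u true) else β y

omit hc in
/-- The part of `β` with prescribed last bit. [folklore] -/
theorem dState_split (β : (Fin (n + 1) → Bool) → ℂ) :
    dState c β = dState c (fun y => if y (Fin.last n) = true then 0 else β y) +
      dState c (fun y => if y (Fin.last n) = true then β y else 0) := by
  rw [← dState_add]
  congr 1
  funext y
  simp only [Pi.add_apply]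
  split <;> simp

omit hc in
/-- A `dState` with amplitudes supported on last bit `b` is supported on half selector `b`. [folklore] -/
theorem dState_apply_eq_zero_of_fh (β : (Fin (n + 1) → Bool) → ℂ) (b : Bool)
    (hβ : ∀ y, y (Fin.last n) ≠ b → β y = 0) (z : QReg (Bsz n L)) (hz : z (fh n L) ≠ b) : dState c β z = 0 := by
  by_cases h : ∃ y tb, z = cfg c y tb
  · obtain ⟨y, tb, rfl⟩ := h
    rw [cfg_apply_fh] at hz
    rw [dState_apply_cfg, hβ y hz]
    simp
  · push Not at h
    exact dState_apply_of_ne c _ h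

omit hc in
/-- Overwriting the low address qubits of a non-configuration gives a non-configuration. [folklore] -/
theorem extend_aEmb'_ne_cfg {z : QReg (Bsz n L)} (hz : ∀ y tb, z ≠ cfg c y tb) (u : Fin n → Bool) :
    ∀ y tb, Function.extend (aEmb' n L) u z ≠ cfg c y tb := by
  intro y tb h
  apply hz (Fin.snoc (z ∘ aEmb' n L) (y (Fin.last n))) tb
  have key : Function.extend (aEmb' n L) (z ∘ aEmb' n L) (Function.extend (aEmb' n L) u z) =
      Function.extend (aEmb' n L) (z ∘ aEmb' n L) (cfg c y tb) := by rw [h]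
  have lhs : Function.extend (aEmb' n L) (z ∘ aEmb' n L) (Function.extend (aEmb' n L) u z) = z := by
    funext p
    by_cases hp : p ∈ Set.range (aEmb' n L)
    · obtain ⟨j, rfl⟩ := hp
      rw [(aEmb' n L).injective.extend_apply]; rfl
    · rw [extend_apply_of_not_mem _ _ _ hp, extend_apply_of_not_mem _ _ _ hp]
  rw [lhs] at key
  conv_lhs => rw [key, ← Fin.snoc_init_self y]
  exact extend_aEmb'_cfg_snoc c (Fin.init y) (z ∘ aEmb' n L) (y (Fin.last n)) tb

omit hc in
/-- **`H^{⊗n}` on the low address qubits of a `dState` supported on half selector `1`.**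
[cite: NielsenChuang2010, §1.4.4] -/
theorem hLayerE'_mulVec_dState_one (β : (Fin (n + 1) → Bool) → ℂ) (hβ : ∀ y, y (Fin.last n) ≠ true → β y = 0) :
    placeGate (aEmb' n L) (hGateAll n) *ᵥ dState c β =
      dState c (fun y => if y (Fin.last n) = true then ∑ u, hGateAll n (Fin.init y) u * β (Fin.snoc u true) else 0) := by
  funext z
  rw [placeGate_mulVec_apply]
  by_cases hz : ∃ y tb, z = cfg c y tb
  · obtain ⟨y, tb, rfl⟩ := hz
    rw [dState_apply_cfg, ← Fin.snoc_init_self y]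
    simp only [cfg_snoc_comp_aEmb', extend_aEmb'_cfg_snoc, dState_apply_cfg, Fin.snoc_last, Fin.init_snoc]
    cases hlast : y (Fin.last n)
    · -- half selector `0`: all summands vanish
      simp only [Bool.false_eq_true, ↓reduceIte]
      rw [Finset.sum_eq_zero]
      · cases tb <;> simp
      · intro u _
        rw [hβ _ (by simp [Fin.snoc_last])]
        cases tb <;> simp
    · simp only [↓reduceIte]
      cases tb
      · simp
      · simp only [↓reduceIte, mul_neg, Finset.sum_neg_distrib]
  · push Not at hz
    rw [dState_apply_of_ne c _ hz, Finset.sum_eq_zero]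
    intro u _
    rw [dState_apply_of_ne c _ (extend_aEmb'_ne_cfg c hz u), mul_zero]

omit hc in
/-- The list `(List.range n).map (foB n L)` is the low address register. [folklore] -/
theorem map_hOn_range_eq_hLayerE :
    ((List.range n).map (foB n L)).map hOn = hLayerE (aEmb' n L) := by
  rw [List.map_map, map_range_eq_map_finRange, hLayerE]
  rfl

omit hc in
/-- **Stage 5** (controlled Hadamards on the low address qubits): `dState β ↦ dState (Tch β)`.
[cite: RazTalJACM2022, §2.2] [cite: NielsenChuang2010, §4.3] -/
theorem chLayer_mulVec_dState (β : (Fin (n + 1) → Bool) → ℂ) (h : ∀ a ∈ (List.range n).map (foB n L), fh n L ≠ a) :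
    (⟨chLayer (fh n L) ((List.range n).map (foB n L)) h⟩ : QCircuit cliffordT (Bsz n L)).toMatrix A *ᵥ dState c β =
      dState c (Tch β) := by
  have h0 : ∀ z : QReg (Bsz n L), z (fh n L) = true → dState c (fun y => if y (Fin.last n) = true then 0 else β y) z = 0 :=
    fun z hz => dState_apply_eq_zero_of_fh c _ false (fun y hy => by
      simp only [ne_eq, Bool.not_eq_false] at hy; simp [hy]) z (by simp [hz])
  have h1 : ∀ z : QReg (Bsz n L), z (fh n L) = false → dState c (fun y => if y (Fin.last n) = true then β y else 0) z = 0 :=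
    fun z hz => dState_apply_eq_zero_of_fh c _ true (fun y hy => by
      simp only [ne_eq, Bool.not_eq_true] at hy; simp [hy]) z (by simp [hz])
  rw [dState_split c β, Matrix.mulVec_add, chLayer_mulVec_of_not_control A (fh n L) _ h h0,
    chLayer_mulVec_of_control A (fh n L) _ h h1, map_hOn_range_eq_hLayerE, toMatrix_hLayerE,
    hLayerE'_mulVec_dState_one c _ (fun y hy => by simp only [ne_eq, Bool.not_eq_true] at hy; simp [hy]), ← dState_add]
  congr 1
  funext y
  simp only [Pi.add_apply, Tch]
  by_cases hy : y (Fin.last n) = true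
  · simp [hy, Fin.snoc_last]
  · simp [hy]

/-! ### The quantum part: composition -/

/-- **The amplitudes of one run of the one-query algorithm**: the oracle signs, then the mixing
`V = H_h ∘ CH^{⊗n}`. [cite: RazTalJACM2022, §2.2 and §6] -/
def blockAmp (y : Fin (n + 1) → Bool) : ℂ := Th (Tch fun y => sgnC (chi c A y)) y

omit hc in
/-- `compileList` of Hadamards is the list of Hadamards. [folklore] -/
theorem compileList_map_had {N : ℕ} (ws : List (Fin N)) (h : ∀ op ∈ ws.map RtOp.had, op.WF) :
    RtOp.compileList (ws.map RtOp.had) h = ws.map hOn := by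
  induction ws with
  | nil => rfl
  | cons w ws ih =>
    change RtOp.compileList (RtOp.had w :: ws.map RtOp.had) h = _
    rw [RtOp.compileList_cons, ih]; rfl

omit hc in
/-- `compileList` of controlled Hadamards with a common control is the controlled layer. [folklore] -/
theorem compileList_map_chad {N : ℕ} (ctl : Fin N) (ws : List (Fin N)) (h : ∀ op ∈ ws.map (RtOp.chad ctl), op.WF)
    (h' : ∀ a ∈ ws, ctl ≠ a) : RtOp.compileList (ws.map (RtOp.chad ctl)) h = chLayer ctl ws h' := by
  induction ws with
  | nil => rfl
  | cons w ws ih =>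
    change RtOp.compileList (RtOp.chad ctl w :: ws.map (RtOp.chad ctl)) h = _
    rw [RtOp.compileList_cons, chLayer, ih]; rfl

omit hc in
/-- `QCircuit.toMatrix_append` for anonymous-constructor circuits (`rw`-able on `⟨L₁ ++ L₂⟩`):
concatenation multiplies the matrices, second list on the left. [folklore] -/
theorem toMatrix_mk_append {G : QGateSet} {N : ℕ} (L₁ L₂ : List (QGate G N)) :
    (⟨L₁ ++ L₂⟩ : QCircuit G N).toMatrix A = (⟨L₂⟩ : QCircuit G N).toMatrix A * (⟨L₁⟩ : QCircuit G N).toMatrix A :=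
  QCircuit.toMatrix_append A ⟨L₁⟩ ⟨L₂⟩

/-- Segment lemma, stages 1–2. [folklore] -/
theorem seg12_mulVec (hX : ∀ op ∈ [RtOp.cl (ClOp.not (ft n L)), RtOp.had (ft n L)], op.WF) :
    (⟨RtOp.compileList [RtOp.cl (ClOp.not (ft n L)), RtOp.had (ft n L)] hX⟩ : QCircuit cliffordT (Bsz n L)).toMatrix A *ᵥ
      basisState c = invSqrt2 • Dvec c (fun _ => false) := by
  rw [RtOp.compileList_cons, RtOp.compileList_cons, RtOp.compileList, List.append_nil, toMatrix_mk_append,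
    ← Matrix.mulVec_mulVec]
  change (⟨[hOn (ft n L)]⟩ : QCircuit cliffordT (Bsz n L)).toMatrix A *ᵥ
    ((⟨xWord (ft n L)⟩ : QCircuit cliffordT (Bsz n L)).toMatrix A *ᵥ basisState c) = _
  conv_lhs => rw [← cfg_zero_false c hc]
  rw [xWord_ft_mulVec_cfg, QCircuit.toMatrix_cons, QCircuit.toMatrix_nil, Matrix.one_mul, hOn_ft_mulVec_cfg]

omit hc in
/-- Segment lemma, stage 3. [folklore] -/
theorem seg3_mulVec (hX : ∀ op ∈ ((List.range (n + 1)).map (foB n L)).map RtOp.had, op.WF) :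
    (⟨RtOp.compileList (((List.range (n + 1)).map (foB n L)).map RtOp.had) hX⟩ : QCircuit cliffordT (Bsz n L)).toMatrix A *ᵥ
      Dvec c (fun _ => false) = invSqrt2 ^ (n + 1) • dState c (fun _ => 1) := by
  have e : ((List.range (n + 1)).map (foB n L)).map hOn = hLayerE (aEmb n L) := by
    rw [List.map_map, map_range_eq_map_finRange]; rfl
  rw [compileList_map_had, e, hLayer_mulVec_Dvec_zero]

omit hc in
/-- Segment lemma, stage 4. [folklore] -/
theorem seg4_mulVec (hX : ∀ op ∈ [RtOp.oracle ((queryWires n L).map (foB n L)) (ft n L)], op.WF)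
    (β : (Fin (n + 1) → Bool) → ℂ) :
    (⟨RtOp.compileList [RtOp.oracle ((queryWires n L).map (foB n L)) (ft n L)] hX⟩ : QCircuit cliffordT (Bsz n L)).toMatrix A *ᵥ
      dState c β = dState c (fun y => sgnC (chi c A y) * β y) := by
  rw [RtOp.compileList_cons, RtOp.compileList, List.append_nil, RtOp.compile, QCircuit.toMatrix_cons,
    QCircuit.toMatrix_nil, Matrix.one_mul, oracle_mulVec_dState]

omit hc in
/-- Segment lemma, stage 5. [folklore] -/
theorem seg5_mulVec (hX : ∀ op ∈ ((List.range n).map (foB n L)).map (RtOp.chad (fh n L)), op.WF)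
    (β : (Fin (n + 1) → Bool) → ℂ) :
    (⟨RtOp.compileList (((List.range n).map (foB n L)).map (RtOp.chad (fh n L))) hX⟩ : QCircuit cliffordT (Bsz n L)).toMatrix A *ᵥ
      dState c β = dState c (Tch β) := by
  have hne : ∀ a ∈ (List.range n).map (foB n L), fh n L ≠ a := by
    intro a ha
    obtain ⟨l, hl, rfl⟩ := List.mem_map.1 ha
    rw [List.mem_range] at hl
    intro e; have := congrArg Fin.val e
    rw [val_fh, val_foB (by unfold Bsz; omega)] at this; omega
  rw [compileList_map_chad (fh n L) _ _ hne, chLayer_mulVec_dState]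

omit hc in
/-- Segment lemma, stage 6. [folklore] -/
theorem seg6_mulVec (hX : ∀ op ∈ [RtOp.had (fh n L)], op.WF) (β : (Fin (n + 1) → Bool) → ℂ) :
    (⟨RtOp.compileList [RtOp.had (fh n L)] hX⟩ : QCircuit cliffordT (Bsz n L)).toMatrix A *ᵥ dState c β = dState c (Th β) := by
  rw [RtOp.compileList_cons, RtOp.compileList, List.append_nil, RtOp.compile, QCircuit.toMatrix_cons,
    QCircuit.toMatrix_nil, Matrix.one_mul, hOn_fh_mulVec_dState]

/-- **The quantum part of a block on the prefix state**: the compiled quantum operations map the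
basis state `c` (vanishing on the address register and the target) to
`2^{-(n+2)/2} ∑_y blockAmp(y) (|cfg y 0⟩ − |cfg y 1⟩)`. [cite: RazTalJACM2022, §2.2 and §6] -/
theorem compileList_quantOps_mulVec
    (h : ∀ op ∈ (quantOps n L).map (RtOp.map (foB n L)), op.WF) :
    (⟨RtOp.compileList ((quantOps n L).map (RtOp.map (foB n L))) h⟩ : QCircuit cliffordT (Bsz n L)).toMatrix A *ᵥ
        basisState c = invSqrt2 ^ (n + 2) • dState c (blockAmp c A) := by
  -- split the program
  have hsplit : (quantOps n L).map (RtOp.map (foB n L)) =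
      ([RtOp.cl (ClOp.not (ft n L)), RtOp.had (ft n L)] ++ ((List.range (n + 1)).map (foB n L)).map RtOp.had) ++
        ([RtOp.oracle ((queryWires n L).map (foB n L)) (ft n L)] ++
          (((List.range n).map (foB n L)).map (RtOp.chad (fh n L)) ++ [RtOp.had (fh n L)])) := by
    simp [quantOps, RtOp.map, ClOp.map, ft, fh, List.map_map, Function.comp_def]
  rw [RtOp.compileList_congr hsplit h (fun op hop => h op (hsplit ▸ hop)), RtOp.compileList_append,
    RtOp.compileList_append, RtOp.compileList_append, RtOp.compileList_append]
  rw [toMatrix_mk_append, toMatrix_mk_append, toMatrix_mk_append, toMatrix_mk_append]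
  simp only [Matrix.mul_assoc]
  simp only [← Matrix.mulVec_mulVec]
  rw [seg12_mulVec c A hc, Matrix.mulVec_smul, seg3_mulVec, smul_smul, ← pow_succ', Matrix.mulVec_smul, seg4_mulVec,
    Matrix.mulVec_smul, Matrix.mulVec_smul, seg5_mulVec, seg6_mulVec]
  simp only [mul_one]
  rfl


/-! ### Addresses as numbers -/

omit hc in
/-- The number `∑_l u_l 2^l < 2ⁿ` with binary digits `u` (Mathlib's `finFunctionFinEquiv`). [folklore] -/
def idxOf {k : ℕ} (u : Fin k → Bool) : Fin (2 ^ k) := finFunctionFinEquiv fun l => if u l then 1 else 0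

omit hc in
/-- The binary digits of `idxOf u` are `u`. [folklore] -/
@[simp] theorem testBit_idxOf {k : ℕ} (u : Fin k → Bool) (l : Fin k) : (idxOf u).val.testBit l = u l := by
  rw [idxOf, testBit_fin]; simp

omit hc in
/-- `idxOf` is injective. [folklore] -/
theorem idxOf_injective {k : ℕ} : Function.Injective (idxOf (k := k)) := by
  intro u u' h
  funext l
  rw [← testBit_idxOf u l, ← testBit_idxOf u' l, h]

omit hc in
/-- `idxOf` is a bijection `{0,1}^k ≃ [2^k]`. [folklore] -/
def idxEquiv (k : ℕ) : (Fin k → Bool) ≃ Fin (2 ^ k) :=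
  Equiv.ofBijective idxOf ((Fintype.bijective_iff_injective_and_card _).2 ⟨idxOf_injective, by simp⟩)

omit hc in
/-- `idxEquiv` is `idxOf`. [folklore] -/
@[simp] theorem idxEquiv_apply {k : ℕ} (u : Fin k → Bool) : idxEquiv k u = idxOf u := rfl

omit hc in
/-- The value of `idxOf (snoc u b)`: `idxOf u + b 2ⁿ`. [folklore] -/
theorem val_idxOf_snoc (u : Fin n → Bool) (b : Bool) :
    (idxOf (Fin.snoc u b) : ℕ) = (idxOf u : ℕ) + (if b then 2 ^ n else 0) := by
  simp only [idxOf, finFunctionFinEquiv_apply, Fin.sum_univ_castSucc, Fin.snoc_castSucc, Fin.snoc_last,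
    Fin.val_castSucc, Fin.val_last]
  cases b <;> simp

omit hc in
/-- The address of block position `k` of the level-`n` window as an element of `[2N]`, from its bits. [folklore] -/
def kFin (y : Fin (n + 1) → Bool) : Fin (2 * 2 ^ n) := finCongr (pow_succ' 2 n) (idxOf y)

omit hc in
/-- The bits of `kFin y` are `y`. [folklore] -/
theorem natBits_kFin (y : Fin (n + 1) → Bool) : natBits (n + 1) (kFin y) = List.ofFn y := by
  unfold natBits
  congr 1
  funext j
  simp [kFin]

omit hc in
/-- `kFin (snoc u 0)` is in the first block: it is `xIdx (idxOf u)`. [folklore] -/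
theorem kFin_snoc_false (u : Fin n → Bool) : kFin (Fin.snoc u false) = xIdx n (idxOf u) := by
  apply Fin.ext
  simp [kFin, val_idxOf_snoc, xIdx, splitIndex]

omit hc in
/-- `kFin (snoc u 1)` is in the second block: it is `yIdx (idxOf u)`. [folklore] -/
theorem kFin_snoc_true (u : Fin n → Bool) : kFin (Fin.snoc u true) = yIdx n (idxOf u) := by
  apply Fin.ext
  simp [kFin, val_idxOf_snoc, yIdx, splitIndex]

/-- **The block read by the query**: bit `k` is `[natBits (n+1) k ++ (index bits of c) ∈ A]`.
[cite: RazTalJACM2022, App. A] -/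
def cWindow : Fin (2 * 2 ^ n) → Bool := fun k =>
  A.boolIndicator (natBits (n + 1) k ++ (List.range L).map fun l => c (foB n L (bW n l)))

omit hc in
/-- The oracle answer at address bits `y` is bit `kFin y` of the block. [cite: RazTalJACM2022, App. A] -/
theorem chi_eq_cWindow (y : Fin (n + 1) → Bool) : chi c A y = cWindow c A (kFin y) := by
  rw [chi, cWindow, natBits_kFin]

omit hc in
/-- `H^{⊗n}` in the bit basis is the Hadamard transform `H_N` in the number basis.
[cite: RazTalJACM2022, §3.1] [cite: NielsenChuang2010, §1.4.4 eq. (1.50)] -/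
theorem hGateAll_eq_hadamardMatrix (u u' : Fin n → Bool) :
    hGateAll n u u' = (hadamardMatrix n (idxOf u) (idxOf u') : ℂ) := by
  rw [hGateAll, Matrix.of_apply, neg_one_pow_card_filter_and, hadamardMatrix, hadamardSign, twist]
  simp only [testBit_idxOf]
  rw [sqrt_two_pow]
  push_cast
  rw [div_eq_mul_inv, mul_comm, ← inv_pow]
  congr 1
  refine Finset.prod_congr rfl fun l _ => ?_
  cases u l <;> cases u' l <;> simp

/-! ### Born weights of `dState` -/

omit hc in
/-- **Born weights of a `dState`**: the weight of an event `P` is the sum of `|β(y)|²` over the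
configurations `cfg y 0`, `cfg y 1` in `P`. [cite: NielsenChuang2010, §2.2.5] -/
theorem sum_ite_normSq_dState (β : (Fin (n + 1) → Bool) → ℂ) (P : QReg (Bsz n L) → Prop) [DecidablePred P] :
    (∑ z, if P z then ‖dState c β z‖ ^ 2 else 0) =
      ∑ y, ((if P (cfg c y false) then ‖β y‖ ^ 2 else 0) + (if P (cfg c y true) then ‖β y‖ ^ 2 else 0)) := by
  classical
  -- the summand vanishes off the image of `cfg`
  set F : QReg (Bsz n L) → ℝ := fun z => if P z then ‖dState c β z‖ ^ 2 else 0 with hF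
  set g : (Fin (n + 1) → Bool) × Bool → QReg (Bsz n L) := fun p => cfg c p.1 p.2 with hg
  have hginj : Function.Injective g := by
    rintro ⟨y, tb⟩ ⟨y', tb'⟩ h
    obtain ⟨rfl, rfl⟩ := cfg_injective c h
    rfl
  have hsupp : ∀ z, z ∉ Finset.univ.image g → F z = 0 := by
    intro z hz
    have hz' : ∀ y tb, z ≠ cfg c y tb := fun y tb h => hz (Finset.mem_image.2 ⟨(y, tb), Finset.mem_univ _, h.symm⟩)
    simp only [hF, dState_apply_of_ne c β hz']
    simp
  calc ∑ z, F z = ∑ z ∈ Finset.univ.image g, F z :=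
        (Finset.sum_subset (Finset.subset_univ _) fun z _ hz => hsupp z hz).symm
    _ = ∑ p : (Fin (n + 1) → Bool) × Bool, F (g p) := Finset.sum_image fun p _ q _ h => hginj h
    _ = _ := by
      rw [Fintype.sum_prod_type]
      refine Finset.sum_congr rfl fun y _ => ?_
      rw [Fintype.sum_bool, add_comm]
      simp only [hF, hg, dState_apply_cfg]
      congr 1
      split <;> simp

/-! ### The acceptance weights of a block -/

omit hc in
/-- Updating the last bit of `snoc`. [folklore] -/
theorem update_snoc_last (u : Fin n → Bool) (b b' : Bool) :
    Function.update (Fin.snoc u b : Fin (n + 1) → Bool) (Fin.last n) b' = Fin.snoc u b' := by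
  funext j
  rcases Fin.eq_castSucc_or_eq_last j with ⟨j, rfl⟩ | rfl
  · rw [Function.update_of_ne (Fin.castSucc_lt_last j).ne, Fin.snoc_castSucc, Fin.snoc_castSucc]
  · rw [Function.update_self, Fin.snoc_last]

/-- The first half of the block in `{±1}` (as a real vector on `[N]`). [cite: RazTalJACM2022, §6] -/
def xVec : Fin (2 ^ n) → ℝ := fun j => sgn (cWindow c A (xIdx n j))

/-- The second half of the block in `{±1}`. [cite: RazTalJACM2022, §6] -/
def yVec : Fin (2 ^ n) → ℝ := fun j => sgn (cWindow c A (yIdx n j))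

omit hc in
/-- **The final amplitudes in closed form**: at `(u, b)` the amplitude is
`(x_u + (−1)^b (H_N y)_u)/√2`, `x`, `y` the two halves of the block in `{±1}`.
[cite: RazTalJACM2022, §2.2 and §6] -/
theorem blockAmp_snoc (u : Fin n → Bool) (b : Bool) :
    blockAmp c A (Fin.snoc u b) =
      invSqrt2 * ((xVec c A (idxOf u) : ℂ) + sgnC b * ((hadamardMatrix n *ᵥ yVec c A) (idxOf u) : ℂ)) := by
  rw [blockAmp, Th, Fin.snoc_last, update_snoc_last, update_snoc_last, Tch, Tch, Fin.snoc_last, Fin.snoc_last]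
  simp only [Bool.false_eq_true, ↓reduceIte, Fin.init_snoc]
  congr 2
  · rw [xVec, sgnC_eq_sgn, chi_eq_cWindow, kFin_snoc_false]
  · congr 1
    rw [Matrix.mulVec, dotProduct]
    push_cast
    rw [← Fintype.sum_equiv (idxEquiv n) (fun u' => hGateAll n u u' * sgnC (chi c A (Fin.snoc u' true)))
      (fun j => (hadamardMatrix n (idxOf u) j : ℂ) * (yVec c A j : ℂ)) (fun u' => by
        rw [idxEquiv_apply, hGateAll_eq_hadamardMatrix, yVec, sgnC_eq_sgn, chi_eq_cWindow, kFin_snoc_true])]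

omit hc in
/-- `x` is a `{±1}`-vector: `∑ x_j² = N`. [folklore] -/
theorem sum_xVec_sq : ∑ j, xVec c A j ^ 2 = 2 ^ n := by
  have : ∀ j, xVec c A j ^ 2 = 1 := fun j => by unfold xVec sgn; split <;> norm_num
  simp [this]

omit hc in
/-- `H_N y` has `∑ (H_N y)_j² = N` (`H_N` is orthogonal, `y ∈ {±1}^N`). [cite: RazTalJACM2022, §3.1] -/
theorem sum_hadamard_yVec_sq : ∑ j, ((hadamardMatrix n *ᵥ yVec c A) j) ^ 2 = 2 ^ n := by
  have h := dotProduct_hadamard_mulVec n (yVec c A)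
  simp only [dotProduct] at h
  simp only [sq]
  rw [h]
  have : ∀ j, yVec c A j * yVec c A j = 1 := fun j => by unfold yVec sgn; split <;> norm_num
  simp [this]

omit hc in
/-- The cross term is the Forrelation: `∑_j x_j (H_N y)_j = N φ(x, y)`. [cite: RazTalJACM2022, §6] -/
theorem sum_xVec_mul_hadamard_yVec :
    ∑ j, xVec c A j * (hadamardMatrix n *ᵥ yVec c A) j = 2 ^ n * forrelationPhi n (fun k => sgn (cWindow c A k)) := by
  unfold forrelationPhi
  rw [mul_div_cancel₀ _ (by positivity)]
  simp only [Matrix.mulVec, dotProduct, Finset.mul_sum, xVec, yVec]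
  refine Finset.sum_congr rfl fun i _ => Finset.sum_congr rfl fun j _ => ?_
  ring

omit hc in
/-- **The sum of the squared amplitudes on half selector `b`**:
`∑_u (x_u + (−1)^b (H_N y)_u)² = N (2 + 2 (−1)^b φ)`. [cite: RazTalJACM2022, §6] -/
theorem sum_sq_xVec_add (b : Bool) :
    ∑ j, (xVec c A j + sgn b * (hadamardMatrix n *ᵥ yVec c A) j) ^ 2 =
      2 ^ n * (2 + 2 * sgn b * forrelationPhi n (fun k => sgn (cWindow c A k))) := by
  have hs : sgn b ^ 2 = 1 := by unfold sgn; split <;> norm_num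
  have e : ∀ j, (xVec c A j + sgn b * (hadamardMatrix n *ᵥ yVec c A) j) ^ 2 =
      xVec c A j ^ 2 + sgn b ^ 2 * ((hadamardMatrix n *ᵥ yVec c A) j) ^ 2 +
        2 * sgn b * (xVec c A j * (hadamardMatrix n *ᵥ yVec c A) j) := fun j => by ring
  simp_rw [e, hs, one_mul, Finset.sum_add_distrib, ← Finset.mul_sum, sum_xVec_sq, sum_hadamard_yVec_sq,
    sum_xVec_mul_hadamard_yVec]
  ring

omit hc in
/-- `|s (a + σ h)|² = (a + σ h)²/2` for real `a, h` and a sign `σ`. [folklore] -/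
theorem normSq_blockAmp_snoc (u : Fin n → Bool) (b : Bool) :
    ‖blockAmp c A (Fin.snoc u b)‖ ^ 2 =
      (xVec c A (idxOf u) + sgn b * (hadamardMatrix n *ᵥ yVec c A) (idxOf u)) ^ 2 / 2 := by
  rw [blockAmp_snoc, sgnC_eq_sgn, norm_mul, mul_pow]
  have h1 : ‖(invSqrt2 : ℂ)‖ ^ 2 = 1 / 2 := by have := norm_invSqrt2_pow_sq 1; rwa [pow_one, pow_one] at this
  rw [h1]
  have h2 : ((xVec c A (idxOf u) : ℂ) + (sgn b : ℂ) * ((hadamardMatrix n *ᵥ yVec c A) (idxOf u) : ℂ)) =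
      ((xVec c A (idxOf u) + sgn b * (hadamardMatrix n *ᵥ yVec c A) (idxOf u) : ℝ) : ℂ) := by push_cast; ring
  rw [h2, Complex.norm_real, Real.norm_eq_abs, sq_abs]
  ring

omit hc in
/-- **The Born weight of half selector `b` in the final state of a block**:
`∑_{z : z_h = b} |2^{-(n+2)/2} dState(blockAmp)(z)|² = (1 + (−1)^b φ)/2`, i.e. `blockAcc` for `b = 0`
and `1 − blockAcc` for `b = 1` (Raz–Tal §6 / Aaronson–Ambainis Prop. 6: the run accepts with
probability `(1 + φ)/2`). [cite: RazTalJACM2022, §6] [cite: AaronsonAmbainis2018, Prop. 6] -/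
theorem sum_ite_normSq_final (b : Bool) :
    (∑ z : QReg (Bsz n L), if z (fh n L) = b then ‖(invSqrt2 ^ (n + 2) • dState c (blockAmp c A)) z‖ ^ 2 else 0) =
      (1 + sgn b * forrelationPhi n (fun k => sgn (cWindow c A k))) / 2 := by
  have e1 : ∀ z : QReg (Bsz n L), ‖(invSqrt2 ^ (n + 2) • dState c (blockAmp c A)) z‖ ^ 2 =
      (1 / 2) ^ (n + 2) * ‖dState c (blockAmp c A) z‖ ^ 2 := fun z => by
    rw [Pi.smul_apply, smul_eq_mul, norm_mul, mul_pow, norm_invSqrt2_pow_sq]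
  simp_rw [e1]
  have e2 : ∀ z : QReg (Bsz n L), (if z (fh n L) = b then (1 / 2 : ℝ) ^ (n + 2) * ‖dState c (blockAmp c A) z‖ ^ 2 else 0) =
      (1 / 2 : ℝ) ^ (n + 2) * (if z (fh n L) = b then ‖dState c (blockAmp c A) z‖ ^ 2 else 0) := fun z => by
    split <;> simp
  simp_rw [e2]
  rw [← Finset.mul_sum, sum_ite_normSq_dState c (blockAmp c A) (fun z => z (fh n L) = b)]
  simp only [cfg_apply_fh]
  rw [sum_eq_sum_snoc]
  simp only [Fin.snoc_last, normSq_blockAmp_snoc]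
  have e3 : ∀ u : Fin n → Bool,
      ((if false = b then (xVec c A (idxOf u) + sgn false * (hadamardMatrix n *ᵥ yVec c A) (idxOf u)) ^ 2 / 2 else 0) +
        (if false = b then (xVec c A (idxOf u) + sgn false * (hadamardMatrix n *ᵥ yVec c A) (idxOf u)) ^ 2 / 2 else 0)) +
      ((if true = b then (xVec c A (idxOf u) + sgn true * (hadamardMatrix n *ᵥ yVec c A) (idxOf u)) ^ 2 / 2 else 0) +
        (if true = b then (xVec c A (idxOf u) + sgn true * (hadamardMatrix n *ᵥ yVec c A) (idxOf u)) ^ 2 / 2 else 0)) =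
      (xVec c A (idxOf u) + sgn b * (hadamardMatrix n *ᵥ yVec c A) (idxOf u)) ^ 2 := fun u => by
    cases b <;> simp
  simp_rw [e3]
  rw [Fintype.sum_equiv (idxEquiv n) _ (fun j => (xVec c A j + sgn b * (hadamardMatrix n *ᵥ yVec c A) j) ^ 2)
    (fun u => by rw [idxEquiv_apply]), sum_sq_xVec_add]
  rw [pow_succ, pow_succ, one_div, inv_pow]
  field_simp

end Quantum

/-! ### The block circuit: assembly -/

section Block

variable {n L : ℕ} (A : Language Bool)

/-- `compileList` of classical operations acts on basis states by `clEval`. [cite: AroraBarak2009, §10.3.7 Lemma 10.10] -/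
theorem compileList_map_cl_mulVec_basisState {N : ℕ} :
    ∀ (ops : List (ClOp (Fin N))) (h : ∀ op ∈ ops.map RtOp.cl, op.WF) (w : QReg N),
      (⟨RtOp.compileList (ops.map RtOp.cl) h⟩ : QCircuit cliffordT N).toMatrix A *ᵥ basisState w =
        basisState (clEval ops w)
  | [], _, w => by simp [RtOp.compileList]
  | op :: ops, h, w => by
    change (⟨(RtOp.cl op).compile _ ++ RtOp.compileList (ops.map RtOp.cl) _⟩ : QCircuit cliffordT N).toMatrix A *ᵥ
      basisState w = _
    rw [toMatrix_mk_append, ← Matrix.mulVec_mulVec, RtOp.compile, RevOp.compile_mulVec_basisState, ClOp.eval_toRev,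
      compileList_map_cl_mulVec_basisState ops _ _, clEval_cons]

/-- The state of the block after its classical prefix, as a basis label of the block register. [folklore] -/
def cPre (n L i : ℕ) : QReg (Bsz n L) := fun p => clEval (prefixOps n L i) (fun _ => false) p

/-- The prefix state vanishes on the address register and the target. [folklore] -/
theorem cPre_of_lt (i : ℕ) (p : Fin (Bsz n L)) (hp : (p : ℕ) < n + 2) : cPre n L i p = false :=
  clEval_prefixOps_of_lt hp _

/-- The prefix state holds `i` in binary on the index register. [cite: RazTalJACM2022, App. A] -/
theorem cPre_bW (i : ℕ) {l : ℕ} (hl : l < L) : cPre n L i (foB n L (bW n l)) = i.testBit l := by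
  unfold cPre
  rw [val_foB (bW_lt_Bsz hl)]
  exact (incInv_prefixOps i).bits l hl

/-- **The block of the window read by block `i`**: bit `k` is `[natBits (n+1) k ++ natBits L i ∈ A]`
(for `L = rtIdxBits n` this is `rtWindow A n i k`). [cite: RazTalJACM2022, App. A] -/
def blockWindow (n L i : ℕ) : Fin (2 * 2 ^ n) → Bool := fun k => A.boolIndicator (natBits (n + 1) k ++ natBits L i)

/-- The window of the prefix state is the block window. [cite: RazTalJACM2022, App. A] -/
theorem cWindow_cPre (i : ℕ) : cWindow (cPre n L i) A = blockWindow A n L i := by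
  funext k
  unfold cWindow blockWindow natBits
  congr 2
  rw [map_range_eq_map_finRange, List.ofFn_eq_map]
  exact List.map_congr_left fun j _ => cPre_bW i j.isLt

/-- **The final state of block `i`**: `2^{-(n+2)/2} ∑_y blockAmp(y) (|cfg y 0⟩ − |cfg y 1⟩)` over the
prefix state. [cite: RazTalJACM2022, §2.2, §6 and App. A] -/
theorem Qloc_mulVec_zero (i : Fin (rtBlocks n)) :
    (Qloc n L i).toMatrix A *ᵥ basisState (fun _ => false) =
      invSqrt2 ^ (n + 2) • dState (cPre n L i) (blockAmp (cPre n L i) A) := by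
  have hsplit : (blockOps n L i).map (RtOp.map (foB n L)) =
      ((prefixOps n L i).map (ClOp.map (foB n L))).map RtOp.cl ++ (quantOps n L).map (RtOp.map (foB n L)) := by
    simp [blockOps, List.map_map, Function.comp_def, RtOp.map]
  unfold Qloc
  rw [RtOp.compileList_congr hsplit _ (fun op hop => (wf_map_finOf_of (Bsz_pos n L) (blockOps_wf (n := n) (L := L) i)
      (blockOps_lt (le_of_lt i.isLt))) op (hsplit ▸ hop)), RtOp.compileList_append, toMatrix_mk_append,
    ← Matrix.mulVec_mulVec, compileList_map_cl_mulVec_basisState]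
  have hc : clEval ((prefixOps n L i).map (ClOp.map (foB n L))) (fun _ => false) = cPre n L i := by
    funext p
    rw [foB, clEval_map_finOf_apply (Bsz_pos n L) _ (fun op hop w hw => (prefixOps_wires (le_of_lt i.isLt) hop hw).2)]
    unfold cPre
    congr 1
    funext q
    simp [liftW]
  rw [hc, compileList_quantOps_mulVec (cPre n L i) A (cPre_of_lt i)]

/-- **The acceptance weights of block `i`.** In the final state of the block circuit on `|0…0⟩`, the
Born weight of `{half selector = 0}` is `blockAcc n (blockWindow A n L i) = (1 + φ)/2` and that of
`{half selector = 1}` is `1 − blockAcc`. [cite: RazTalJACM2022, §6 and Claim 8.1] [cite: AaronsonAmbainis2018, Prop. 6] -/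
theorem sum_ite_normSq_Qloc (i : Fin (rtBlocks n)) (b : Bool) :
    (∑ z : QReg (Bsz n L), if z (fh n L) = b then ‖((Qloc n L i).toMatrix A *ᵥ basisState (fun _ => false)) z‖ ^ 2 else 0) =
      if b then 1 - blockAcc n (blockWindow A n L i) else blockAcc n (blockWindow A n L i) := by
  rw [Qloc_mulVec_zero, sum_ite_normSq_final, cWindow_cPre, blockAcc]
  cases b
  · simp [sgn]
  · simp [sgn]; ring

end Block

end RazTalMachine

end Literature.Computability.QuantumComplexity

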